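import Mathlib
import HarnessLib
import HarnessLib.Audit
import Summits.ABC.Statement
import Literature.NumberTheory.EllipticCurves.ModularCurve
import Literature.NumberTheory.EllipticCurves.Isogeny
import Literature.Barriers.ABC.BakerMethodBounds
import Literature.NumberTheory.DiophantineGeometry.FaltingsHeight
import HarnessLib.Audit.Status.Attr

/-!
Route: IsogenyGlueCongruence

DORMANT since 2026-08-25T15:22:58Z (reconciler: no traction for 7.8 d (last activity item-evidence-added at 2026-08-17T19:18:26Z); parked, not closed — `ledger route dormant route-ABC-IsogenyGlueCongruence --off` to reactivate) — unstaffed, not closed; items shared with open routes are served there. `ledger route dormant <id> --off` reactivates.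

Route IsogenyGlueCongruence — realises idea card ABC/ABC/isogeny-glue-congruence-primes ("a deep
congruence is a cheap isogeny"). Rev 4 (promote-to-A, 2026-08-15): typed lever U. Rev 9–10
(2026-08-16): deciding theorem through crux A with both levers (U, K) glued to A. Rev 17–18
(right-size to D-0019 caps, 2026-08-16, rchoice f5c24d87): 15 items / 6 cruxes; the deciding theorem
runs THROUGH THE LEVER U and the proved glue (closes hU hJ hMK hMod hHofMK hGlueU hB hSharp hP
hFrame), 13 of 15 items in its cone; the K → A glue (PROVED in Theorems), the parked modularity
slice, the known d = 1 calibration PolyFreyMazurPairs, the misstated PolyAbcOfPolyDegree and the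
rev-14 Faltings wiring were de-itemised (theorems stay landed; see RANKED CRUXES).

THESIS X (it suffices to show X). X = the modular-degree conjecture for SEMISTABLE elliptic curves
over ℚ, sharp form: for every ε > 0 there is C(ε) such that every semistable E/ℚ, given by a
globally minimal model W of conductor N = W.conductorNorm ℤ, admits a modular parametrisation X₀(N)
→ E of degree ≤ C(ε)·N^(2+ε).
Lean (decl SemistableDegreeConjecture): ∀ ε > 0, ∃ C, ∀ (W : WeierstrassCurve ℚ) [W.IsElliptic]
[W.IsGloballyMinimal] [NeZero (W.conductorNorm ℤ)], W.IsSemistable ℤ → ∃ D :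
ModularParametrizationData W (W.conductorNorm ℤ), (D.modularDegree : ℝ) ≤ C * N ^ (2 + ε).

X → ABC is known (items FrameOverPetersson — PROVED, frameOverPetersson_proof — and Assembly; the
8th-power normalisation Assembly2 is PROVED and retired): Zagier's formula deg(φ)·covol(Λ_E) =
4π²c²(f,f) (PROVED in tree) with c ∈ ℤ∖{0}, (f,f) ≫ N^(1−ε) (HoffsteinLockhart1994; item
PeterssonLowerBound, the one undischarged analytic input), Silverman's archimedean inequality
(PROVED) and the Frey curve of a normalised triple (N = rad, semistable, PROVED) give c < C(ε')
rad(abc)^(1+ε'); in tree as abcLe_of_semistableDegreeBound + abcLt_of_abcLe. References: Frey1989;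
MurtyCongruencePrimes1999 Thm 1; PastenShimura2024 §3 and Rem 3.3.

THE LEVER (rev 4, typed, rank 2): E-MULTIPLIERS. For abelian varieties E, B over ℚ with E an
AV-model of the elliptic curve W (E(ℚ̄) ≃ W(ℚ̄) Γ_ℚ-equivariantly) call n ∈ ℤ an E-multiplier of B
when α ≫ β = n • 𝟙 E for some α : E ⟶ B, β : B ⟶ E. Two computations. (i) B = J₀(N), W the optimal
curve of a semistable class of conductor N: the multipliers are exactly m_E·ℤ (π ∘ π^∨ = [deg φ];
Hom(J₀(N), E) = ℤ·π by multiplicity one), so "ℓ divides every E-multiplier of J₀(N)" ⟺ ℓ ∣ m_E. (ii)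
B = (E × A)/graph(ι) for a GL₂-type A with Hom(E, A) = 0 and ι : E[ℓ] ↪ A[ℓ] Galois-equivariant (the
card's glued variety): every multiplier is divisible by ℓ. Crux U = EllipticGluingPrimeBound: a
prime dividing every E-multiplier of B (some non-zero multiplier existing) is ≤ C·(dim B · max(1,
h_F(W)))^κ with ABSOLUTE κ ≥ 0, C; h_F = stableFaltingsHeight (a real definition) — the statement is
T-free. Instance (i) + h_F(W) ≤ c·N² (PastenShimura2024 Thm 1.9) + dim J₀(N) ≤ N² gives crux A
(every prime factor of m_E is ≤ C'·N^(4κ)) through the typed, provable-now glue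
DegreePrimesOfGluingBound; instance (ii) is the informal height-form torsion-sharing bound K1 of rev
≤ 3 with the partner's height dropped (forced: the Faltings height of a non-elliptic abelian variety
exists in the tree only as the hypothesis structure FaltingsHeightTheory, against which upper bounds
are unfaithful). KNOWN: for dim B ≤ g₀ and with the partner's height kept, GaudronRemond2023 Thm
1.3(1) (isogenies E × C ⇄ B of degree ≤ Υ^(2e), e(E × A) = 2 + 2d for an RM partner of dimension d)
with Thm 1.8 (Υ ≤ 241(en)^(2n) n⁵ [K:ℚ] max(1, log[K:ℚ], h_F + 3/2·dim)), or Thm 1.9(1) (Ξ(A)²,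
exponent 2g² in h_F), give ℓ ≤ c(g₀)·max(1, h_F(E) + h_F(B/E))^κ(g₀); d = 1 is
MasserWustholzBLMS1993 (vendored pair form GaudronRemond2023_torsionHom_ellipticPair). THE BET is
uniformity in dim B (entering polynomially) and in the partner (entering only through dim B): a
semi-uniform statement of Frey–Mazur type (Frey1997; CremonaFreitas2021: the largest known
torsion-sharing prime between non-isogenous curves over ℚ is 17). WHY PRIME-BY-PRIME: the multiplier
form ("the least positive E-multiplier is ≤ C(dim B·h)^κ") is FALSE — the composite cyclotomic
gluing B = M ⊗ E (MazurRubinSilverberg2007 Def 1.1, Prop 1.6, Thm 2.1–2.2, with M ⊂ ℤ ⊕ ⊕ᵢ ℤ[ζ_{pᵢ}]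
the Γ_ℚ-lattice glued along the augmentations, Galois acting through a cyclic group of order ∏pᵢ)
has E of multiplicity one, h_F(B) = dim B·h_F(E) exactly, and least multiplier ∏pᵢ =
exp((1+o(1))·√(dim B·log dim B)); but every prime dividing all multipliers of a twist M ⊗ E divides
the order of the finite group through which Γ_ℚ acts on M, hence is ≤ rank M + 1 = dim B + 1. Sizes
of primes can be uniform, products cannot — exactly this route's split into crux A (sizes) and crux
B (depth × multiplicity).

LINE OF ATTACK (D-0019, two layers, crux-first). Layer 1 (ranked): U EllipticGluingPrimeBound (rank
2; typed; the bet) > K TorsionSharingPrimeBound (stmt-ABC-2157, rank 2 historical; rev-4 SIGNATURE =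
the level form, informally 'CongruencePartnerBound': a congruence of f_E — E semistable of conductor
N — with any OTHER newform g of ANY level M modulo a prime above ℓ forces ℓ ≤ C(MN)^κ; the faithful,
non-semi-uniform form of K1, equivalent to A on partners of level M ∣ N modulo Ribet1990 /
Carayol1989 / DiamondTaylor1994 / AgasheRibetStein2012 but stated per partner, the shape the
transcendence mechanism addresses, and the fallback lead if U dies by semi-uniformity) ≥ A
DegreePrimesPolyBounded (rank 3; typed necessary condition of X and of ABC) > B
PolyDegreeOfBoundedPrimes (rank 4; depth × multiplicity) > R SharpDegreeOfPolyDegree (rank 5; the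
declared abc-strength residual). Layer 2 (typed): MazurKenkuBound (crux rank 9 — KNOWN in print,
Mazur1978 + Kenku1982, XL formal debt with a live line; verbatim
PastenShimura2024_minimalDegree_le_163_mul), and support ModularJacobianMultipliers (fact-shaped:
J₀(N) as an abelian variety over ℚ, an AV-model of W, dim ≤ N², a minimal datum D with
D.modularDegree dividing every multiplier), ModularDatumExists (modularity with integral Manin
constant, verbatim nonempty_modularParametrizationData; KNOWN — Wiles1995/TaylorWiles1995/BCDT2001 —
parked formal debt, support since rev 17), SemistableHeightPolyBound (h_F(W) ≤ c·N²) with its PROVED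
derivation SemistableHeightPolyBoundOfMazurKenku (MazurKenkuBound → ModularDatumExists →
SemistableHeightPolyBound, via PastenShimura2024 Thm 5.5 = tree theorem), DegreePrimesOfGluingBound
(U → J → H → A, PROVED), PeterssonLowerBound (HoffsteinLockhart1994, the one undischarged analytic
input), FrameOverPetersson (P → X → abc, PROVED), Assembly (X → ABC, = Frame + P; undroppable, not
used by closes). DECIDING THEOREM (rev 18): closes hU hJ hMK hMod hHofMK hGlueU hB hSharp hP hFrame
:= hFrame hP (hSharp (hB (hGlueU hU hJ (hHofMK hMK hMod)))) — cone = {U, J, MK, Mod, HofMK, H,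
GlueU, A, B, R, X, P, Frame}, 13 of 15 items; outside the cone only K (the alternative lever: its
glue K → DegreePrimeCongruence → A is PROVED in Theorems — degreePrimesOfCongruenceBound_proof over
degreePrimeCongruence_of_datum — and was de-itemised at rev 18 because an alternative derivation of
A is a sibling route sharing A, B, R, P, Frame, X, to be opened when K is promoted to lead) and
Assembly. Open leaves of the cone: U (the bet), B, R (abc-strength residual), and the known-in-print
inputs J, MK, Mod, P.
HONEST ENDPOINT: unchanged — the mechanism reaches the POLYNOMIAL waypoint (Frey's height conjecture
= PastenShimura2024 Conj 3.2 restricted to semistable curves); the step N^κ' → N^(2+ε) (item R) is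
not decomposed and not claimed reachable by this mechanism. Level-lowering congruence primes are
free (ρ̄_{E,ℓ} unramified at p ∣ N forces ℓ ∣ v_p(Δ_E) ≤ (12h+16)/log 2: Tate curve, Ribet1990), so
the single live enemy of U, K, A alike is a same-level congruence of f_E with a giant newform orbit
at a huge prime.

Rationale: WHY THIS LINE. ABC ⟺ the modular-degree conjecture for Frey curves (Frey1989;
MurtyCongruencePrimes1999 Thm 1; PastenShimura2024 Rem 3.3), and deg φ_E is assembled from
congruence primes of f_E (Ribet: m_E ∣ r_E, AgasheRibetStein2012 Thm 2.1; PastenShimura2024 Thm 1.8: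
δ ∣ ∏ η). Every unconditional bound (MurtyCongruencePrimes1999; PastenShimura2024 Thm 1.9: h(E) <
(1/48+ε) N log N) is exponential in the dimension d of the congruence partner because it passes
through norms of a_p(f) − a_p(g) (Sturm1987). The card imports TRANSCENDENCE on abelian varieties
(MasserWustholz1993, MasserWustholzBLMS1993, GaudronRemondPeriodes2014, GaudronRemond2023): a
congruence mod ℓ glues E to A_g along E[ℓ] and isogeny theorems bound ℓ polynomially in heights —
today with exponent 2e(E × A_g) = 4 + 4d (GaudronRemond2023 Thm 1.3(1), e = 2 + 2d for an RM
partner; pp. 12–16 read) and constant (en)^(2n) (Thm 1.8). Rev 4 replaces the informal height-form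
K1 (not typable faithfully: FaltingsHeightTheory is a hypothesis structure and ∀T-statements with
h_F(A), dim A ≥ 2, inside an upper bound are undercut — FaltingsHeight.lean docstring,
GaudronRemondEllipticPairs.lean) by the E-MULTIPLIER lever U, which (a) isolates the prime ℓ from
the class-group / discriminant part of Gaudron–Rémond's d and Υ (the route review asked for "an
ℓ-isolating estimate": for B = E × A the multiplier 1 occurs whatever disc(End A) is, while for the
glued variety every multiplier is in ℓℤ), (b) has the modular degree itself as an instance (B =
J₀(N): multipliers = m_E·ℤ), so ONE statement feeds crux A through a typed, provable-now glue and
the deciding theorem runs through the lead crux, and (c) is T-free (only h_F(E) =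
stableFaltingsHeight, a real definition, appears). Level-lowering congruence primes are free (Tate
curve + Ribet1990: ℓ ∣ v_p(Δ_E) ≤ (12h+16)/log 2), so the one live enemy is a same-level congruence
of f_E with a giant orbit at a huge prime. Areas imported: diophantine approximation on abelian
varieties (isogeny/period theorems), arithmetic of J₀(N) (Ribet, ARS, optimal quotients,
multiplicity one), Galois-module twists (MazurRubinSilverberg2007) for the calibrating examples,
Arakelov heights (PastenShimura2024, Ullmo2000). Dead ends checked this pass (not to be re-filed):
Faltings' isogeny formula is blind to m_E (the kernel E[m] of E × E^⊥ → J₀(N) has full differential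
defect, h(J) = h(E) + h(E^⊥)); geometry of numbers on (S₂(Γ₀(N); ℤ), Petersson) expresses r_E =
‖f‖·covol(f^⊥ ∩ S₂(ℤ))/covol(S₂(ℤ)) but Minkowski/Hadamard lose e^(O(g)) = e^(O(N)) in dimension g ≍
N/12, the size of the trivial bound; the MULTIPLIER (non-prime) form of U is false (composite
cyclotomic gluing, thesis).
RANKED CRUXES. U EllipticGluingPrimeBound (stmt-ABC-13919; rank 2; typed, T-free; the bet;
semi-uniform: the partner enters only through dim B) > K TorsionSharingPrimeBound (stmt-ABC-2157;
rank 2 historical; its rev-4 signature — the first this item ever had — is the per-partner LEVEL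
form ℓ ≤ C(MN)^κ for congruences of f_E with any other newform of any level M; faithful and NOT
semi-uniform; equivalent to A on level-dividing partners modulo named facts; cheaply testable on
LMFDB/Cremona congruence tables) ≥ A DegreePrimesPolyBounded (rank 3; every prime factor of the
modular degree of a semistable E/ℚ is ≤ C N^κ; necessary for X and, through Frey curves, for ABC) >
B PolyDegreeOfBoundedPrimes (rank 4; depth × multiplicity: A → polynomial modular degree; the
composite-gluing example shows B needs J₀(N)-specific input, gluing structure alone allows Σ log ℓ ≍
√(dim)) > R SharpDegreeOfPolyDegree (rank 5; abc-strength residual polynomial → N^(2+ε), no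
mechanism claimed). RE-SIGNED, NOT DROPPED: the informal height-form K1 of rev ≤ 3 (stmt-ABC-2157)
could not be typed faithfully (h_F of a non-elliptic abelian variety exists only as the hypothesis
structure FaltingsHeightTheory); the item received as its first signature the faithful level form
recommended by route review #3 (iv), and its torsion-sharing content moved into U's instance (ii).
The stale informal paragraph in its docstring is superseded by the signature + the rev-4 retriage
note; nothing was refuted. Target SemistableDegreeConjecture (rank 0); Assembly X → ABC (rank 1; =
FrameOverPetersson + PeterssonLowerBound; undroppable, counted, not a hypothesis of closes). Crux
rank 9 (KNOWN in print, formal debt, live line): MazurKenkuBound (stmt-ABC-15125). Support (rank 9):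
ModularJacobianMultipliers (fact-shaped modular instance of U), SemistableHeightPolyBound (Pasten,
crude all-N form) and its PROVED derivation SemistableHeightPolyBoundOfMazurKenku (stmt-ABC-15128),
ModularDatumExists (stmt-ABC-15126; known, parked, support since rev 17), DegreePrimesOfGluingBound
(U → facts → A; PROVED), PeterssonLowerBound (named fact as item, shared with route DefiniteXi),
FrameOverPetersson (PROVED). DE-ITEMISED AT REV 18 (items cap 15; every theorem stays landed,
nothing refuted): DegreePrimeCongruence + DegreePrimesOfCongruenceBound (proved) +
DegreePrimeCongruenceOfMazurKenku (proved) = the K → A glue; SemistableModularDatum (held slice) +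
SemistableHeightPolyBoundOfSemistableModularity; PolyFreyMazurPairs (known d = 1 calibration,
polyFreyMazurPairs_of_exists_isNewformOf p87921); PolyAbcOfPolyDegree (refuted-misstated ×3, p83047;
repaired forms bakerShapeBound_zero_one_of_polyDegreeAll / polyAbcSixteen… live in Theorems);
FaltingsTate + EllipticGluingPrimeBoundOfFaltings (rev-14 wiring, 0 references): the U-line's
Faltings-conditional composition lands as the Theorems theorem (∀ A B ℓ [Fact ℓ.Prime] [NumberField
ℚ], Bijective (faltingsTateMap A B ℓ)) → EllipticGluingPrimeBound and is re-itemised in ONE slot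
(Faltings body inlined, as P is inlined in FrameOverPetersson) as soon as K leaves for its sibling
route — never again as a separate FaltingsTate crux (2 slots; its text trips the auto-crux lint).
KILL CRITERIA. (i) U refuted by a family (B_n ⊃ E_n)/ℚ with a prime ℓ_n dividing all E_n-multipliers
and log ℓ_n / log(dim B_n · max(1, h_F(E_n))) → ∞. If the family has dim B_n bounded and partner
heights → ∞ (a semi-uniformity failure, e.g. bounded-dimensional level-raising partners of a fixed
curve at unbounded primes), U dies but K and A survive: pivot the lead to K (same mechanism, partner
height restored as the level M): re-itemise DegreePrimeCongruence + the PROVED glue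
DegreePrimesOfCongruenceBound in the two slots freed by U's J-instance items and re-point closes
(hGlueK hK hCong for hGlueU hU hJ hH) — a re-wiring, not a rewrite; or open the K sibling route
outright. If instead the partner heights stay polynomial in dim·h(E), the transcendence line is
dead: close the route exhausted (A, B remain bare waypoints shared with cards
definite-quaternion-xi-szpiro / frey-congruence-anatomy). (ii) K or A refuted — a semistable E/ℚ
whose modular degree has a prime factor beyond every C N^κ, or congruences f_E ≡ g (mod λ ∣ ℓ) with
ℓ > C(MN)^κ for all C, κ along a family — refutes X, hence (Murty Thm 1) is negative knowledge of
summit size. (iii) Data: Watkins2002 / Cremona–LMFDB modular degrees or congruence tables showing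
prime factors ℓ of deg φ_E with ℓ > N² in bulk ⇒ suspect-false on K, A (AgasheRibetStein2012 checked
r_E, m_E for all N ≤ 557; nothing of the kind is reported). (iv) If a proof of U is shown to need
Coleman-type uniformity of Υ (GaudronRemond2023 §1.5 p. 16: the bounds of Thm 1.9 are uniform iff Υ
is bounded in terms of [K:ℚ] and n), record the dependence and downgrade U to a conditional bridge
on Coleman's conjecture.
NOT DECOMPOSED YET. The proof of U — a new isogeny/period theorem for pairs (B, E) whose exponent
does not grow with dim B (Gaudron–Rémond's Υ-formalism gives Υ^(2e(E×C)), e ≥ dim); no split is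
proposed before a crux-ideate round names a line (candidates recorded for it: work O_F-linearly with
the rank-2 structure of T_ℓ(A_g) over End ⊗ ℤ_ℓ, GaudronRemond2023 §1.2 C₀,#; or bound the E-part of
a nuclear isogeny, Thm 1.6–1.7, separately from the similar part). The glue K → A is PROVED
(degreePrimesOfCongruenceBound_proof over the fact-shaped DegreePrimeCongruence =
degreePrimeCongruence_of_datum: Ribet/AgasheRibetStein2012 Thm 2.1, Deligne–Serre lifting — proved
in tree —, Atkin–Lehner–Li, Mazur1978; no level lowering needed since K quantifies over every level
M and the fact delivers M ∣ N) and de-itemised at rev 18. HOUSEKEEPING for tenure: the item budget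
is FULL (15/15; cruxes 6/7: U2 K2 A3 B4 R5 MK9) and Assembly is undroppable and counted, so every
addition needs a drop; the natural next move is K → sibling route (K, DegreePrimeCongruence,
DegreePrimesOfCongruenceBound sharing A/B/R/P/Frame/X), which also frees the slot for the inlined
Faltings-conditional U item. K, MazurKenkuBound, ModularDatumExists, ModularJacobianMultipliers,
SemistableHeightPolyBound are pinned by live leads or live crux-workfile imports — do not drop them.
B needs modularity-specific input beyond gluing (composite example). Above all R: polynomial →
N^(2+ε) is not claimed by any mechanism here (isogeny estimates lose fixed powers of h ≍ N log N,
Sturm loses N); its line is blocked-on X by the provers' own analysis (stub ≡ R ≡ (Poly → ABC) mod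
facts, p96082/p99967).
CHEAPEST FALSIFIER. For K and A: scan LMFDB/Cremona congruence and modular-degree data (Watkins2002
degrees; newform congruence primes versus levels M, N) for a prime ℓ ∣ m_E, or a congruence prime
between f_E and another newform of level M, with ℓ > (MN)²; none is expected (ARS: N ≤ 557 clean).
For U: its d = 1 instance — non-isogenous E, E'/ℚ with E[ℓ] ≅ E'[ℓ] for some ℓ ≥ 19 and h(E) small
would already strain it (CremonaFreitas2021: none known beyond ℓ = 17; uniform Frey–Mazur predicts
none), while the whole twist class M ⊗ E (cyclotomic A_ψ, Weil restrictions, composite gluings) is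
provably harmless (primes ≤ dim B + 1) and rational ℓ-isogenies give ℓ ≤ 163 (Mazur1978).

Novelty: Nearest prior art (searched 2026-08-15: crossref 'Masser Wüstholz isogeny estimates', 'Gaudron
Rémond isogénies', 'isomorphic mod l Galois representations elliptic curves isogenous height bound',
'effective Frey-Mazur conductor'; local hybrid 'degree conjecture modular parametrization Frey abc',
'modular degree conjecture implies abc congruence primes Murty'; galaxy all 'Bounds for congruence
primes'; zbMATH x3 on the card): MasserWustholzBLMS1993 = doi:10.1112/blms/25.3.247 (E[l] = E'[l], l
> c h^gamma => isogenous: the gluing-to-isogeny mechanism, d = 1); GaudronRemond2023 =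
doi:10.24033/msmf.484 Thm 1.5(1), 1.8, 1.9(4) (explicit division-point/isogeny bounds in any
dimension; exponent 2+2d, constant d^O(d^2)); MasserWustholz1993 = doi:10.2307/2946529;
GaudronRemond2014; MurtyCongruencePrimes1999 (congruence-prime bounds via Sturm + norms, exponential
in [K_g:Q]; Thm 1: abc <=> degree conjecture for Frey curves); PastenShimura2024 = arXiv:1705.09251
Thm 1.8 (delta | prod eta), Thm 1.9 (h(E) < (1/48+eps) N log N), Conj 3.2, Rem 3.3; MurtyPasten2013.
Nothing found bounds congruence primes of f_E polynomially in N for partners of unbounded dimension,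
and no dimension-uniform division-field theorem for GL2-type varieties is stated in
GaudronRemond2023 or its references. Delta: (i) the abc-relevant output of transcendence is isolated
as ONE uniformity statement (K1: exponent independent of dim A for GL2-type A, torsion-sharing
form), (ii) the necessary conditions of ABC it would  [refs: 10.1112/blms/25.3.247, 10.24033/msmf.484, 10.2307/2946529, 1705.09251, doi:10.1112/blms/25.3.247, doi:10.24033/msmf.484, doi:10.2307/2946529, MasserWustholzBLMS1993, GaudronRemond2023, MasserWustholz1993, GaudronRemond2014, MurtyCongruencePrimes1999, PastenShimura2024, MurtyPasten2013]

Barriers (technique_class: isogeny-estimate-congruence-gluing): technique_class: isogeny-estimate-congruence-gluing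
- Literature.Barriers.ABC.BakerMethodBounds: transcendence enters through
isogeny/polarisation/period estimates (MasserWustholz1993, GaudronRemond2023) with the Faltings
height inside a POLYNOMIAL, not through linear forms in logarithms; with h_F << N log N
(PastenShimura2024 Thm 1.9) every output (K1 => crux A, support S1) is polynomial in N, i.e. of
shape BakerShapeBound 0 1 at worst, outside the blocked class BakerShapeBound theta>0; the route
does not use Baker–Wüstholz/Yu estimates anywhere.
- Literature.Barriers.ABC.EpsilonCannotBeDropped: respected — the target X keeps C(eps) N^(2+eps),
the assembly yields c < C(eps') rad^(1+eps'), and the waypoint is N^kappa (polynomial abc =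
BakerShapeBound 0 1, explicitly NOT blocked); no eps-free, uniform-constant or polylog-loss
statement is filed.
- Literature.Barriers.ABC.SzpiroEpsilonCannotBeDropped: respected — polynomial/6+eps Szpiro only
ever appears with a free exponent or with eps (via 12 h_F <= (6+eps) log N + O(1)); Masser's
semistable witnesses are consistent with every item.
- Literature.Barriers.ABC.IUTDisputedClaim: nothing from IUT is imported; all facts used carry cite
tags (Zagier formula proved in tree, Frey-curve invariants proved in tree, HoffsteinLockhart1994,
Ribet/ARS, BLR, Mazur, GaudronRemond2023).
- Negatives index for ABC: empty (2026-08-15); no refuted statement is restated.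

Novelty grade: new-combination — ROUTE REVIEW gen-1 (refuter 5830665c, 2026-08-15T13:55Z; 5th pass, CONCUR with 120149d4/3f7689a0/1d743afd/d6c52f0b; deltas only; full text review_IGC.txt in my folder). Re-verified: 6 typed decls rc0; X ⟹ A proved inline (A necessary for X, and for ABC via ABC ⟹ gen. Szpiro ⟹ X); IsIsogenous/geomTor (refuter refuter-rreview-route-ABC-DefiniteXi-rou-5830665c-0, 2026-08-15T13:49:10Z; prior: doi:10.1112/blms/25.3.247, doi:10.24033/msmf.484, doi:10.1007/bf01444715, doi:10.1090/pspum/066.1/1703750, arXiv:1705.09251, route-ABC-QuaternionicDegree)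

History (route lifecycle, newest last):
- 2026-08-16T02:17:40Z · AUTO-CRUX: 2 conjecture-grade item(s) promoted to crux (SemistableDegreeConjecture, PolyFreyMazurPairs) — refuter vetting / tiering apply (operator:999:1362873)
- 2026-08-16T14:15:59Z · LINT AUTOFIX: dropped duplicate assembly item(s) Assembly2 (kept the one `closes` uses) (operator:gate4)
- 2026-08-16T14:44:06Z · rev 18: dropped DegreePrimeCongruenceOfMazurKenku, DegreePrimeCongruence, DegreePrimesOfCongruenceBound, SemistableModularDatum, SemistableHeightPolyBoundOfSemistableModularity, PolyFreyMazurPairs, PolyAbcOfPolyDegre — right-size (rchoice f5c24d87; caps crux 8>7, items 16>15 incl. the undroppable Assembly): closes now  (planner-rchoice-ABC-IsogenyGlueCongruence-rq-r-f5c24d87-0)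
- 2026-08-25T15:22:58Z · DORMANT — reconciler: no traction for 7.8 d (last activity item-evidence-added at 2026-08-17T19:18:26Z); parked, not closed — `ledger route dormant route-ABC-IsogenyGlueC (operator:999:160895)

sub-problem: ABC · status: dormant · opened planner-plancard-ABC-ABC-isogeny-glue-congrue-45cca654-0 2026-08-15T11:00:25Z · rev 34 · ledger route-ABC-IsogenyGlueCongruence
GENERATED by the gate from the ledger (D-0016/17). Provers cite these decls: `theorem foo : Summit.ABC.ABC.Theses.IsogenyGlueCongruence.<Decl> := …` in Summits/ABC/ABC/Theorems/<Name>.lean.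
-/

namespace Summit.ABC.ABC.Theses.IsogenyGlueCongruence

open scoped BigOperators Topology Manifold Classical MeasureTheory ProbabilityTheory Matrix InnerProductSpace ComplexConjugate ContinuousMap
open Filter Set Function TopologicalSpace MeasureTheory

attribute [summit_statement] _root_.ABC

open Literature.Abc

/-- item stmt-ABC-2044 · target · rank 0 · open · by planner
why it might fail: Fails iff some semistable family has minimal modular degree ≥ N^(2+δ); for Frey curves that is exactly ¬ABC (Murty 1999 Thm 1), so no independent evidence; Watkins' tables (degrees up to ~N^1.4) are consistent; only log deg φ ≪ N log N is proved (PastenShimura2024 Thm 1.9).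
sources: MurtyCongruencePrimes1999, PastenShimura2024, Frey1989, Watkins2002, ZagierCMB1985
[target] Modular-degree conjecture, SEMISTABLE case, sharp exponent: every semistable E/ℚ, given by
a globally minimal model W with N = W.conductorNorm ℤ, has a modular parametrisation datum D at
level N with deg ≤ C(ε)·N^(2+ε). The ∃D form bundles modularity (Literature fact
ModularForms.nonempty_modularParametrizationData); for a non-optimal W in its class deg = deg_opt ×
(isogeny degree ≤ 163, Mazur–Kenku), harmless. For Frey–Hellegouarch curves X is equivalent to ABC
(MurtyCongruencePrimes1999 Thm 1 p.180; PastenShimura2024 Rem 3.3 fills the Manin-constant gap);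
Frey1989 / PastenShimura2024 Conj 3.2 state the polynomial form log δ ≪ log N (that is the route's
waypoint, see PolyDegreeOfBoundedPrimes). Typical size deg φ_E = N^(1+o(1)) with excursions
(Watkins2002). Sources: MurtyCongruencePrimes1999, PastenShimura2024, Frey1989, ZagierCMB1985,
Watkins2002. -/
@[route_item "route-ABC-IsogenyGlueCongruence", crux]
def SemistableDegreeConjecture : Prop :=
  ∀ ε : ℝ, 0 < ε → ∃ C : ℝ, ∀ (W : WeierstrassCurve ℚ) [W.IsElliptic] [W.IsGloballyMinimal] [NeZero (W.conductorNorm ℤ)], W.IsSemistable ℤ → ∃ D : Literature.NumberTheory.EllipticCurves.ModularForms.ModularParametrizationData W (W.conductorNorm ℤ), (D.modularDegree : ℝ) ≤ C * (W.conductorNorm ℤ : ℝ) ^ (2 + ε)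

/-- item stmt-ABC-13919 · crux · rank 2 · open · by planner
why it might fail: Semi-uniform: a fixed E congruent mod unboundedly large ℓ to bounded-dimensional GL₂-type partners of huge level refutes it yet contradicts nothing proven (only Frey–Mazur-type expectations); dim-uniform isogeny theorems are beyond print (GR2023 §1.5).
sources: GaudronRemond2023, MasserWustholzBLMS1993, MasserWustholz1993, GaudronRemondPeriodes2014, MazurRubinSilverberg2007, Frey1997
[crux] [crux U, rank 2 — the route's lever and bet; typed, T-free] EllipticGluingPrimeBound. Call n
∈ ℤ an E-multiplier of B (E, B abelian varieties over ℚ, E an AV-model of the elliptic curve W: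
E(ℚ̄) ≃ W(ℚ̄) Γ_ℚ-equivariantly) when α ≫ β = n • 𝟙 E for some α : E ⟶ B, β : B ⟶ E. Statement:
there are ABSOLUTE κ ≥ 0, C such that for every prime ℓ: if a non-zero multiplier exists (E is an
isogeny factor of B) and ℓ divides EVERY multiplier, then ℓ ≤ C·(dim B · max(1, h_F(W)))^κ, h_F =
stableFaltingsHeight (real definition). Instances: (i) B = J₀(N), W optimal semistable of conductor
N: multipliers = m_E·ℤ (π∘π^∨ = [deg φ]; Hom(J₀(N), E) = ℤπ by multiplicity one), so with dim J₀(N)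
≤ N² and h_F ≤ cN² (Pasten) U gives crux A — typed glue DegreePrimesOfGluingBound (closes runs
through U); (ii) B = (E × A)/graph(ι), A GL₂-type, Hom(E, A) = 0, ι : E[ℓ] ↪ A[ℓ] equivariant: every
multiplier ∈ ℓℤ, so U is the torsion-sharing bound K1 of rev ≤ 3 with the partner's height DROPPED
(semi-uniform) — forced, because h_F of a non-elliptic abelian variety exists in the tree only as
the hypothesis structure FaltingsHeightTheory, against which upper bounds are unfaithful
(FaltingsHeight.lean docstring -/
@[route_item "route-ABC-IsogenyGlueCongruence", crux (bottleneck := idea) (experiment := "instrument: c920fb · LIT-WATCH v6.1 cf9dc36be23b8022 · kernel map `Summits/ABC/Analytic/` + `FunctionField/TransferSheetSixFifths.lean` 16 files / 35 p…") (source := "director HOURLY-ABC l.1291 + director HOURLY-ABC l.1288, 2026-09-01")]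
def EllipticGluingPrimeBound : Prop :=
  ∃ κ C : ℝ, 0 ≤ κ ∧ ∀ (W : WeierstrassCurve ℚ) [W.IsElliptic] (E B : Literature.AlgebraicGeometry.Motives.AbelianVariety.{0} ℚ) (e : E.geomPoints ≃+ W.geomPoints), (∀ (σ : Field.absoluteGaloisGroup ℚ) (P : E.geomPoints), e (σ • P) = σ • e P) → ∀ ℓ : ℕ, ℓ.Prime → (∃ (α : E ⟶ B) (β : B ⟶ E) (n : ℤ), n ≠ 0 ∧ CategoryTheory.CategoryStruct.comp α β = n • CategoryTheory.CategoryStruct.id E) → (∀ (α : E ⟶ B) (β : B ⟶ E) (n : ℤ), CategoryTheory.CategoryStruct.comp α β = n • CategoryTheory.CategoryStruct.id E → (ℓ : ℤ) ∣ n) → (ℓ : ℝ) ≤ C * ((B.dim : ℝ) * max 1 W.stableFaltingsHeight) ^ κ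

/-- item stmt-ABC-2157 · crux · rank 2 · open · by planner
why it might fail: A congruence of f_E with a giant newform orbit (dim ≍ N) at the same squarefree level modulo ℓ ≈ exp(N^δ) contradicts nothing known — Sturm/norm and isogeny bounds are exponential in the orbit dimension; on partners of level M ∣ N it is equivalent to crux A.
sources: MurtyCongruencePrimes1999, Sturm1987, AgasheRibetStein2012, Ribet1990, Carayol1989, DiamondTaylor1994
[crux K1, rank 2 — the route's bet; INFORMAL until the notion faltingsHeight lands (definition
request filed)] TorsionSharingPrimeBound: there are ABSOLUTE constants C, κ such that for every
elliptic curve E/ℚ, every abelian variety A/ℚ of GL₂-type (End⁰_ℚ(A) ⊇ a number field of degree d =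
dim A) with Hom_ℚ(E, A) = 0, and every prime ℓ admitting a Gal(ℚ̄/ℚ)-equivariant injection E[ℓ](ℚ̄)
↪ A[ℓ](ℚ̄), one has ℓ ≤ C·(d·max(1, h_F(E), h_F(A)))^κ (h_F = stable Faltings height). Intended Lean
shape once faltingsHeight : AbelianVariety ℚ → ℝ exists: ∃ κ C, ∀ (W : WeierstrassCurve ℚ)
[W.IsElliptic] (A : Literature.AlgebraicGeometry.Motives.AbelianVariety ℚ) (RM field of degree A.dim
in endAlgebra A) (no nonzero morphism from an abelian-variety model of W to A) (ℓ prime) (ι :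
W.geomTorsion ℓ →+ ℓ-torsion of A.geomPoints, injective, Galois-equivariant), ℓ ≤ C * (A.dim * max 1
(max h_F(W) h_F(A))) ^ κ. KNOWN with κ(d) = 2+2d, C(d) = d^O(d²): GaudronRemond2023
(doi:10.24033/msmf.484) Thm 1.5(1) (for A′, B′ in the class of the reference variety C₀ = E × A the
cokernel of Hom(A′,B′) → Hom_Gal(A′[m],B′[m]) has exponent ∣ d_C^(1/2), d_C ≤ Υ^(2n)) + Thm 1.8 (Υ ≤
241·(en)^(2n)·n^5·[K:ℚ]·max(1, log[K -/
@[route_item "route-ABC-IsogenyGlueCongruence", crux]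
def TorsionSharingPrimeBound : Prop :=
  ∃ κ C : ℝ, 0 ≤ κ ∧ ∀ (W : WeierstrassCurve ℚ) [W.IsElliptic] [W.IsGloballyMinimal] [NeZero (W.conductorNorm ℤ)], W.IsSemistable ℤ → ∀ (M : ℕ) [NeZero M] (g : CuspForm (CongruenceSubgroup.Gamma0 M) 2), Literature.NumberTheory.EllipticCurves.ModularForms.IsNewform0 g → ¬ Literature.NumberTheory.EllipticCurves.ModularForms.IsNewformOf W g → ∀ ℓ : ℕ, ℓ.Prime → ∀ (R : Subring ℂ) (F : Type) [Field F] [CharP F ℓ] (φ : R →+* F) (hg : ∀ n : ℕ, Literature.NumberTheory.EllipticCurves.ModularForms.cuspCoeff g n ∈ R), (∀ p : ℕ, p.Prime → ¬ (p ∣ M * W.conductorNorm ℤ * ℓ) → φ ⟨Literature.NumberTheory.EllipticCurves.ModularForms.cuspCoeff g p, hg p⟩ = ((W.LFunction p : ℤ) : F)) → (ℓ : ℝ) ≤ C * ((M : ℝ) * (W.conductorNorm ℤ : ℝ)) ^ κ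

/-- item stmt-ABC-2045 · crux · rank 3 · open · by planner
why it might fail: deg φ_E may be as large as e^(2h(E)) and only h(E) ≲ N log N/48 is proved; a single congruence of f_E with a giant newform orbit (dim ≍ N) modulo a prime ℓ ≈ exp(N^δ) contradicts nothing known — Murty's and Gaudron–Rémond's bounds are exponential in the orbit dimension.
sources: MurtyCongruencePrimes1999, PastenShimura2024, GaudronRemond2023, AgasheRibetStein2011, ZagierCMB1985, Watkins2002
[crux A, rank 3] Every prime factor ℓ of the modular degree of a semistable E/ℚ satisfies ℓ ≤ C·N^κ
with ABSOLUTE κ, C (∃D form as in the target; primes ℓ ∣ N or ℓ ≤ 163 are trivially fine). NECESSARY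
for the target X (deg ≤ C N^(2+ε)) and hence, through Frey curves, for ABC: a refutation here
refutes the summit. Route plan (layer-2 glue, filed when K1 closes): K1 TorsionSharingPrimeBound +
[ℓ ∣ deg φ_E ⟹ ℓ ∣ congruence number r_E (AgasheRibetStein2011 Thm 2.1: m_E ∣ r_E; Ribet,
ZagierCMB1985 Thm 3) ⟹ f_E ≡ g (mod λ ∣ ℓ) for a Hecke eigenform g ∉ ℂ·f_E of level M ∣ N ⟹ for ℓ ≥
11 (Mazur: ρ̄_{E,ℓ} irreducible, E semistable) a Gal(ℚ̄/ℚ)-equivariant injection E[ℓ] ↪ A_g[λ] ⊂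
A_g[ℓ] (Boston–Lenstra–Ribet), Hom(E, A_g) = 0, d = dim A_g ≤ N/12 + 1] + [h_F(E) < (1/48+ε) N log N
(PastenShimura2024 Thm 1.9); h_F(A_g) ≤ h_F(J₀(M)) + O(d·N log N) via the optimal quotient and
Bost's lower bound (Ullmo 2000; Jorgenson–Kramer), WITHOUT re-importing a congruence modulus] ⟹ ℓ ≤
C·(d²·N log N)^κ ≤ C'·N^(3κ+1). Known unconditionally only for partners of bounded dimension d₀: ℓ
≪_{d₀} (N log N)^(2+2d₀) (GaudronRemond2023 Thm 1.5(1) + Thm 1.8). Cheap refutation attempt: scan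
Cremona/Watkins modular-de -/
@[route_item "route-ABC-IsogenyGlueCongruence", crux]
def DegreePrimesPolyBounded : Prop :=
  ∃ κ C : ℝ, ∀ (W : WeierstrassCurve ℚ) [W.IsElliptic] [W.IsGloballyMinimal] [NeZero (W.conductorNorm ℤ)], W.IsSemistable ℤ → ∃ D : Literature.NumberTheory.EllipticCurves.ModularForms.ModularParametrizationData W (W.conductorNorm ℤ), ∀ ℓ : ℕ, ℓ.Prime → ℓ ∣ D.modularDegree → (ℓ : ℝ) ≤ C * (W.conductorNorm ℤ : ℝ) ^ κ

/-- item stmt-ABC-16006 · crux · rank 4 · open · by planner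
why it might fail: Open exactly when H is (polynomial Szpiro for semistable curves, Pasten Conj 3.1): A gives no known leverage (abstract 'prime sizes ⇒ size' is false, p82575); fails iff a semistable family has log max(|Δ|,|c₄|³)/log N → ∞ while every prime factor of deg φ stays ≤ C N^κ.
sources: Frey1989, PastenShimura2024, MurtyCongruencePrimes1999, Silverman1986, Masser1990, FouvryNairTenenbaum1992
[crux] B' (rank 4) — the HEIGHT-FORM re-cut of crux B (route-choice 05c66fb8, 2026-08-16; file
ManinBoundOfFacts × fact Edixhoven 1991 Prop 2, XL-apex): granted crux A (DegreePrimesPolyBounded: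
every prime factor of the modular degree of a semistable E/ℚ is ≤ C·N^κ), the POLYNOMIAL HEIGHT
CONJECTURE for semistable curves — ∃ σ C, for every semistable elliptic W/ℚ on a global minimal
model, max(|Δ_W|, |c₄(W)|³) ≤ C·N_W^σ (Frey1989 height conjecture = PastenShimura2024 Conj 3.1
restricted to semistable curves = polynomial Szpiro in the max(|Δ|,|c₄|³) form, exponent FREE;
Masser1990 / SzpiroEpsilonCannotBeDropped only forbid a fixed exponent 6). RELATION TO B =
PolyDegreeOfBoundedPrimes (A → polynomial modular degree P; stmt-ABC-2046, now support): B → B'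
UNCONDITIONALLY (Theorems polyHeight_of_polyDegreeOfBoundedPrimes, p102896: P → H by Zagier's
identity, (f,f) ≫ N^(1/4) and Silverman's covolume inequality, all proved) and B' → B modulo the
named facts Edixhoven 1991 Prop 2 + Česnavičius 2018 Thm 1.2 + the item MazurKenkuBound
(polyDegreeOfBoundedPrimes_iff_polyHeight_of_facts, p114386). So B' is B with its MANIN INPUT
removed: four lead seats on B (Cruxes/PolyDegreeOfBoundedPrimes/ -/
@[route_item "route-ABC-IsogenyGlueCongruence", crux]
def PolyHeightOfBoundedPrimes : Prop :=
  DegreePrimesPolyBounded → ∃ σ C : ℝ, ∀ (W : WeierstrassCurve ℚ) [W.IsElliptic] [W.IsGloballyMinimal] [NeZero (W.conductorNorm ℤ)], W.IsSemistable ℤ → ((max |W.Δ| (|W.c₄| ^ 3) : ℚ) : ℝ) ≤ C * (W.conductorNorm ℤ : ℝ) ^ σ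

/-- item stmt-ABC-2046 · crux · rank 4 · open · by planner
why it might fail: Bounding prime SIZES leaves depths and the number of congruence primes free; with Maeda-type giant orbits at squarefree level, Sturm + norms give only log η ≲ (dim g/2)·log N ≍ N log N; no mechanism forcing shallow congruences with giant orbits is known — B may be as hard as the height conjecture.
sources: PastenShimura2024, MurtyCongruencePrimes1999, Sturm1987, AgasheRibetStein2011, Frey1989
[crux B, rank 4 — the card's K2, depth × multiplicity] Granted crux A (all prime factors of modular
degrees of semistable curves are ≤ C N^κ), show the POLYNOMIAL modular-degree conjecture for
semistable E/ℚ: ∃ κ' C', deg φ_E ≤ C'·N^κ' (= Frey's height conjecture, PastenShimura2024 Conj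
3.1/3.2 = Frey1989, restricted to semistable curves; it implies polynomial Szpiro and polynomial
abc, support PolyAbcOfPolyDegree). Mechanism wanted: log deg φ_E = Σ_λ e_λ f_λ log ℓ over the
congruence primes λ of f_E with the other Hecke eigen-systems (PastenShimura2024 Thm 1.8: δ ∣
∏_{[χ]≠[χ₀]} η_{[χ₀]}([χ])); per partner orbit g the only general tool, Sturm's bound + coefficient
norms (Sturm1987, MurtyCongruencePrimes1999), gives log η_g ≤ (dim g / 2)·log(16 N), whose sum over
orbits is the trivial (N/24) log N; what is needed is SHALLOWNESS of the congruences with giant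
orbits (Σ_λ e_λ f_λ bounded for each partner, boundedly many deep partners), not paucity of
partners. Both sides of the implication are consequences of X; the item is global (A → Poly), so a
proof may use A only through the sizes of the primes. Sources: PastenShimura2024,
MurtyCongruencePrimes1999, Sturm1987, AgasheRibetStein2011 -/
@[route_item "route-ABC-IsogenyGlueCongruence", crux]
def PolyDegreeOfBoundedPrimes : Prop :=
  DegreePrimesPolyBounded → ∃ κ C : ℝ, ∀ (W : WeierstrassCurve ℚ) [W.IsElliptic] [W.IsGloballyMinimal] [NeZero (W.conductorNorm ℤ)], W.IsSemistable ℤ → ∃ D : Literature.NumberTheory.EllipticCurves.ModularForms.ModularParametrizationData W (W.conductorNorm ℤ), (D.modularDegree : ℝ) ≤ C * (W.conductorNorm ℤ : ℝ) ^ κ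

/-- item stmt-ABC-10895 · crux · rank 5 · open · by planner
why it might fail: abc-strength: no amplification from a fixed exponent κ to 2+ε is known for modular degrees, Szpiro or abc (weak abc does not give strong abc); Watkins-type excursions deg φ ≥ N^(2+δ) in a semistable family would refute it together with X.
sources: MurtyCongruencePrimes1999, PastenShimura2024, Frey1989, Watkins2002, StewartYu2001
[crux] R (rank 5) — the declared abc-strength RESIDUAL, not claimed by the mechanism: the polynomial
modular-degree conjecture for semistable curves (∃ κ C, deg ≤ C N^κ in the ∃D form = the consequent
of PolyDegreeOfBoundedPrimes) implies the sharp one, X = SemistableDegreeConjecture (∀ ε, deg ≤ C(ε)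
N^(2+ε)). Both sides are open and, on Frey curves, X ⟺ ABC (MurtyCongruencePrimes1999 Thm 1) while
the antecedent ⟺ polynomial abc; the item is true iff X is (given the antecedent), so it carries no
independent evidence and no route mechanism reaches it: isogeny estimates lose fixed powers of h ≍ N
log N, Sturm bounds lose N. Filed on the route review's recommendation (refuter 5830665c, DELTA 2:
'add the abc-strength crux PolyDegree → X explicitly') so that the deciding theorem runs through the
cruxes instead of assuming X: closes hA hB hSharp hP hFrame := hFrame hP (hSharp (hB hA)). Anyone
attacking it directly is attacking X. WHY IT MIGHT FAIL: abc-strength — no amplification from a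
fixed exponent κ to 2+ε is known for modular degrees, Szpiro or abc (weak abc does not give strong
abc); Watkins-type excursions deg φ ≥ N^(2+δ) in a semistable family would refute it together with X
(the -/
@[route_item "route-ABC-IsogenyGlueCongruence", crux]
def SharpDegreeOfPolyDegree : Prop :=
  (∃ κ C : ℝ, ∀ (W : WeierstrassCurve ℚ) [W.IsElliptic] [W.IsGloballyMinimal] [NeZero (W.conductorNorm ℤ)], W.IsSemistable ℤ → ∃ D : Literature.NumberTheory.EllipticCurves.ModularForms.ModularParametrizationData W (W.conductorNorm ℤ), (D.modularDegree : ℝ) ≤ C * (W.conductorNorm ℤ : ℝ) ^ κ) → SemistableDegreeConjecture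

/-- item stmt-ABC-16009 · crux · rank 5 · open · by planner
why it might fail: abc-strength: no amplification from a fixed exponent σ (polynomial Szpiro) to deg φ ≤ C(ε)N^(2+ε) is known (weak abc ⇏ strong abc); Watkins-type excursions deg φ ≥ N^(2+δ) in a semistable family would refute it together with X.
sources: MurtyCongruencePrimes1999, PastenShimura2024, Frey1989, Watkins2002, StewartYu2001
[crux] R' (rank 5) — the declared abc-strength RESIDUAL in HEIGHT form (route-choice 05c66fb8 re-cut
of R = SharpDegreeOfPolyDegree, stmt-ABC-10895, now support): the polynomial height conjecture for
semistable curves (H: ∃ σ C, max(|Δ_W|, |c₄(W)|³) ≤ C·N_W^σ on semistable global minimal models)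
implies the thesis X = SemistableDegreeConjecture (deg ≤ C(ε)·N^(2+ε)). R' → R UNCONDITIONALLY (P →
H, polyHeight_of_polyDegree p102896) and R → R' modulo
Edixhoven/Česnavičius/MazurKenkuBound/ModularDatumExists (P ↔ H, polyDegree_iff_polyHeight_of_facts
p114386). Like R it is true iff X is (given H), carries no independent evidence and no mechanism of
this route reaches it (isogeny estimates lose fixed powers of h ≍ N log N, Sturm loses N); it closes
the day X lands (fun _ ↦ hX; cf. stub_ofTarget p96259 for R) and is otherwise blocked-on X exactly
as R's line found (stub ≡ R ≡ (Poly → ABC) mod facts, p96082/p99967) — the crux chain need not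
re-run that analysis. WHY THE RE-CUT: with B' and R' the deciding theorem carries NO Manin-constant
formal debt; X itself implies a polynomial Manin bound (X → P → M, manin_of_polyDegree p104128), so
the Manin input that the old chain B, R needed now si -/
@[route_item "route-ABC-IsogenyGlueCongruence", crux]
def SharpDegreeOfPolyHeight : Prop :=
  (∃ σ C : ℝ, ∀ (W : WeierstrassCurve ℚ) [W.IsElliptic] [W.IsGloballyMinimal] [NeZero (W.conductorNorm ℤ)], W.IsSemistable ℤ → ((max |W.Δ| (|W.c₄| ^ 3) : ℚ) : ℝ) ≤ C * (W.conductorNorm ℤ : ℝ) ^ σ) → SemistableDegreeConjecture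

/-- item stmt-ABC-15853 · crux · rank 6 · open · by planner
why it might fail: TRUE in print (Kim 2003 Thm B: Sym⁴π_E automorphic on GL₅; cuspidal for non-CM E, Kim–Shahidi 2002; Godement–Jacquet entire; convexity × conductor ≤ N^O(1), Rouse 2007), audited true AS TYPED (cdisprove, line-audit ×2, leads c1–c6). Risk = size: GL(5) functoriality is in no proof assistant; XL.
sources: Kim2003, KimShahidiCusp2002, KimShahidi2002, GodementJacquet1972, IwaniecKowalski2004, Rouse2007
[crux] PROMOTED PRINTED INPUT (route-choice repair e6b77e02, 2026-08-16): the analytic package of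
L(s, Sym⁴ E) for non-CM E/ℚ — verbatim the body of the XL named fact
Literature.NumberTheory.Automorphic.Kim2003_symmFourL_nonCM_entire_polyBound (fully qualified;
Iff.rfl the fact, planner Sketch.lean rc 0; inlined so that no unproved named-fact constant enters
the cone). For an elliptic W/ℚ without CM and its newform f ∈ S₂(Γ₀(N)) (IsNewformOf W f), the
good-prime symmetric fourth power Euler product L^(N)(s, Sym⁴ E) = exp(Σ_{p∤N} Σ_{k≥1} T₄(C_k(Re
a_p(f)/√p)) k⁻¹ p^{−ks}), T₄(x) = x⁴ − 3x² + 1, converges absolutely on Re s > 1 and is the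
restriction of an ENTIRE function L₄ bounded by C·N^K on the disc |s − 2| ≤ 3/2, with absolute C ≥
1, K ≥ 0. In print: Sym⁴π_E is automorphic on GL₅(𝔸_ℚ) (Kim2003 Thm B), cuspidal off the
dihedral/tetrahedral/octahedral types (KimShahidiCusp2002 Thm 3.3.7, Prop 3.3.8; a non-CM weight-2
newform is of none of these, KimShahidi2002 §6), its standard L-function is entire with functional
equation (GodementJacquet1972 Thm 13.8), whence convexity in the conductor aspect
(IwaniecKowalski2004 §5.2) with conductor ≤ N^O(1) (Rouse2007 L 2.1). WHY A CRUX OF THI -/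
@[route_item "route-ABC-IsogenyGlueCongruence"]
def SymmFourAnalyticPackage : Prop :=
  ∃ C K : ℝ, 1 ≤ C ∧ 0 ≤ K ∧ ∀ (N : ℕ) [NeZero N] (W : WeierstrassCurve ℚ) [W.IsElliptic] (f : CuspForm (CongruenceSubgroup.Gamma0 N) 2), Literature.NumberTheory.EllipticCurves.ModularForms.IsNewformOf W f → ¬ W.HasCM → ∃ L₄ : ℂ → ℂ, Differentiable ℂ L₄ ∧ (∀ s : ℂ, 1 < s.re → (∀ p : Nat.Primes, Summable fun k : ℕ ↦ ‖((if ¬ (p : ℕ) ∣ N then (((Polynomial.Chebyshev.C ℝ (k + 1)).eval ((Literature.NumberTheory.EllipticCurves.ModularForms.cuspCoeff f p).re / Real.sqrt p)) ^ 4 - 3 * ((Polynomial.Chebyshev.C ℝ (k + 1)).eval ((Literature.NumberTheory.EllipticCurves.ModularForms.cuspCoeff f p).re / Real.sqrt p)) ^ 2 + 1) / (k + 1) else 0 : ℝ) : ℂ) * (p : ℂ) ^ (-((k + 1 : ℕ) : ℂ) * s)‖) ∧ (Summable fun p : Nat.Primes ↦ ∑' k : ℕ, ‖((if ¬ (p :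 ℕ) ∣ N then (((Polynomial.Chebyshev.C ℝ (k + 1)).eval ((Literature.NumberTheory.EllipticCurves.ModularForms.cuspCoeff f p).re / Real.sqrt p)) ^ 4 - 3 * ((Polynomial.Chebyshev.C ℝ (k + 1)).eval ((Literature.NumberTheory.EllipticCurves.ModularForms.cuspCoeff f p).re / Real.sqrt p)) ^ 2 + 1) / (k + 1) else 0 : ℝ) : ℂ) * (p : ℂ) ^ (-((k + 1 : ℕ) : ℂ) * s)‖) ∧ L₄ s = Complex.exp (∑' p : Nat.Primes, ∑' k : ℕ, ((if ¬ (p : ℕ) ∣ N then (((Polynomial.Chebyshev.C ℝ (k + 1)).eval ((Literature.NumberTheory.EllipticCurves.ModularForms.cuspCoeff f p).re / Real.sqrt p)) ^ 4 - 3 * ((Polynomial.Chebyshev.C ℝ (k + 1)).eval ((Literature.NumberTheory.EllipticCurves.ModularForms.cuspCoeff f p).re / Real.sqrt p)) ^ 2 + 1) / (k + 1) else 0 : ℝ) : ℂ) * (p : ℂ) ^ (-((k + 1 : ℕ) : ℂ) * s))) ∧ ∀ s ∈ Metric.closedBall (2 : ℂ) (3 / 2), ‖L₄ s‖ ≤ C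 * (N : ℝ) ^ K

/-- item stmt-ABC-15125 · crux · rank 9 · SPLIT (gen 1) into MazurCor44, KenkuPrintedLevels, KenkuCompositeTables, KenkuLevelFortyNine + glue MazurKenkuBoundGlue · direct attempts still welcome (low priority) · by planner
why it might fail: KNOWN (Mazur1978 Thm 1 + Kenku1982 + Edixhoven1991 Prop 2): cannot fail in print. Edixhoven input DISCHARGED (stmt-ABC-15990 proved); residual = crux MazurKenkuRadius (stmt-ABC-15193) alone via landed mazurKenkuBound_of_radiusItem. Risk formal: Eisenstein ideal, XL.
sources: Mazur1978, Kenku1982, PastenShimura2024, arXiv:1705.09251, SilvermanAEC2009, EdixhovenManin1991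
[crux, rank 9 — KNOWN in print, XL formal debt; route-choice PROMOTION (planner rchoice 1e5e4a86,
2026-08-16) of the apex Literature fact
Literature.NumberTheory.EllipticCurves.ModularForms.PastenShimura2024_minimalDegree_le_163_mul,
whose body this statement repeats VERBATIM (definitionally equal — Sketch.lean `Iff.rfl`: closable
by `exact PastenShimura2024_minimalDegree_le_163_mul_holds` the day the fact is discharged, and
usable as is wherever a tree theorem takes `(h163 : PastenShimura2024_minimalDegree_le_163_mul)`)]
MazurKenkuBound — the Mazur–Kenku comparison of modular degrees inside an isogeny class: if D is a
parametrisation datum at level N of minimal degree among all data with the same newform (the optimal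
parametrisation, deg D = δ_{1,N}) and D' is a datum of a GLOBALLY MINIMAL elliptic W' with the same
newform, of minimal degree among the data of W' itself, then deg D' ≤ 163·deg D. In print
(PastenShimura2024 §3 p.13): every parametrisation of W' factors through the optimal quotient
followed by an isogeny; ℚ-isogenous curves are joined by a CYCLIC ℚ-isogeny of degree in Kenku's
list {1..19,21,25,27,37,43,67,163} (Mazur1978 Thm 1 for prime degree — Eisenstein ideal —, -/
@[route_item "route-ABC-IsogenyGlueCongruence", crux]
def MazurKenkuBound : Prop :=
  ∀ (N : ℕ) [NeZero N] (W W' : WeierstrassCurve ℚ) [W.IsElliptic] [W'.IsElliptic] [W'.IsGloballyMinimal] (D : Literature.NumberTheory.EllipticCurves.ModularForms.ModularParametrizationData W N) (D' : Literature.NumberTheory.EllipticCurves.ModularForms.ModularParametrizationData W' N), D'.f = D.f → (∀ (W'' : WeierstrassCurve ℚ) [W''.IsElliptic] (D'' : Literature.NumberTheory.EllipticCurves.ModularForms.ModularParametrizationData W'' N), D''.f = D.f → D.modularDegree ≤ D''.modularDegree) → (∀ D'' : Literature.NumberTheory.EllipticCurves.ModularForms.ModularParametrizationData W' N, D'.modularDegree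 ≤ D''.modularDegree) → D'.modularDegree ≤ 163 * D.modularDegree

-- parent: MazurKenkuBound · child (gen 1)
/--     item stmt-ABC-18223 · crux · rank 901 · open
    parent: MazurKenkuBound · by operator
    why it might fail: TRUE in print (Mazur1978 Cor 4.4; as typed: j of every curve with an 11/17/19/37/43/67/163-isogeny has 2-power denominator — checked on the 11 tabulated j). Risk formal only, XL: Eisenstein quotient J̃(ℚ) finite + formal immersion; no Jacobians/modular curves over ℤ in tree.
    sources: Mazur1978, Mazur1977, SilvermanAEC2009
[crux; split child A of MazurKenkuBound (crux-strategist s2, 2026-08-17); PRINTED, XL] Mazur 1978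
Cor. 4.4, VERBATIM the body of the tree's named fact
Literature.NumberTheory.EllipticCurves.Mazur1978.cor44_valuation_j_le_one (Iff.rfl, planner file
DefiniteXiMazurKenkuBoundSplit.lean rc 0): an elliptic curve over ℚ with a rational N-isogeny, N =
11 or N ≥ 17 prime (genus X₀(N) > 0), has ord_v(j) ≥ 0 at every ODD place v (potentially good
reduction away from 2). In print: Eisenstein quotient J̃ of J₀(N) with J̃(ℚ) finite (Mazur 1977
III.3.1) + formal immersion X₀(N) → J̃ at ∞ in odd characteristic (Mazur 1978 Prop. 3.1, Cor. 4.3).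
It is the registered stub `stub_cor44` of BOTH lines of this crux (Sketch, radius-lite), the
residual of the sibling crux MazurKenkuRadius (stmt-ABC-15193: radius ⇒ Mazur Thm 1 at p > 163, tree
`hasIrreducibleModPGaloisRep_of_exists_isogeny_degree_le_163`), of `mazur_isogeny_irreducible`
(open-image / Selmer consumers, `mazur_isogeny_irreducible_holds_of`) and of the prime case of
Mazur's torsion theorem (MazurTorsionPrimeCaseFromCor44Proofs) — ONE landing serves all; filed once
as an item so that it is staffed once. No modular curves over ℤ, Jacobians or N -/
@[route_item "route-ABC-IsogenyGlueCongruence", crux]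
def MazurCor44 : Prop :=
  ∀ (W : WeierstrassCurve ℚ) [W.IsElliptic] (N : ℕ) [Fact N.Prime], (N = 11 ∨ 17 ≤ N) → (∃ C : AddSubgroup (WeierstrassCurve.geomTorsion W N), (∀ σ : Field.absoluteGaloisGroup ℚ, ∀ P ∈ C, σ • P ∈ C) ∧ Nat.card C = N) → ∀ v : IsDedekindDomain.HeightOneSpectrum (NumberField.RingOfIntegers ℚ), (2 : NumberField.RingOfIntegers ℚ) ∉ v.asIdeal → v.valuation ℚ W.j ≤ 1

-- parent: MazurKenkuBound · child (gen 1)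
/--     item stmt-ABC-18224 · crux · rank 902 · open
    parent: MazurKenkuBound · by operator
    why it might fail: TRUE in print (Mazur1978 p.129; MazurSwinnertonDyer1974; Ligozat1975; Kubert1976; Kenku 1979–81; Cremona agrees). Risk formal, XL: moduli interpretation of X₀(p), p ∈ {11,17,19,37,43,67,163}, and rank-0 Eisenstein / abelian-surface quotients for 26, 35, 65, 125, 169 — none in tree.
    sources: Mazur1978, MazurSwinnertonDyer1974, Ligozat1975, Kubert1976, Kenku1982, SilvermanAEC2009
[crux; split child B of MazurKenkuBound (crux-strategist s2); PRINTED, XL] The modular-curve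
determinations of the Kenku half that have NO genus-zero cover and no tree-reachable Mordell–Weil
group: (i) the j-TABLES of rational N-isogenies at the seven PRIME levels N ∈ {11, 17, 19, 37, 43,
67, 163}: a (necessarily cyclic) rational N-isogeny out of V forces (N, j(V)) to be one of the
eleven rows −2¹⁵, −11², −11·131³ (11); −17²·101³/2, −17·373³/2¹⁷ (17); −96³ (19); −7·11³,
−7·137³·2083³ (37); −960³ (43); −5280³ (67); −640320³ (163) — X₀(11), X₀(17), X₀(19) genus 1 rank 0
(Ligozat 1975), X₀(37) genus 2 (Mazur–Swinnerton-Dyer 1974), X₀(43/67/163): cusps + one CM point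
(Mazur 1978 table p. 129); in Lean this needs a MODULI INTERPRETATION of X₀(N) for prime N (no
Klein–Fricke Hauptmodul; the tree's kernel-elimination certificates exist only at 2, 3, 5, 7) plus
the rank-0 / genus-2 descents; (ii) Y₀(N)(ℚ) = ∅ (no cyclic rational N-isogeny) at the five levels
26 (genus 2, Mazur–Vélu/Ogg: 2×13 needs Klein–Fricke 13, absent, and 26a1/26b1 have torsion ℤ/3, ℤ/7
— no 2-isogeny descent), 35 (genus 3, Kubert 1976: fibre product of Klein–Fricke 5 and 7 is typable
but its only elliptic quotient 35a -/
@[route_item "route-ABC-IsogenyGlueCongruence"]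
def KenkuPrintedLevels : Prop :=
  (∀ (V V' : WeierstrassCurve ℚ) [V.IsElliptic] [V'.IsElliptic] (ψ : WeierstrassCurve.Isogeny V V'), ψ.IsCyclic → ψ.degree ∈ ({11, 17, 19, 37, 43, 67, 163} : Finset ℕ) → (ψ.degree, V.j) ∈ ({((11 : ℕ), (-32768 : ℚ)), (11, -121), (11, -24729001), (17, -297756989 / 2), (17, -882216989 / 131072), (19, -884736), (37, -9317), (37, -162677523113838677), (43, -884736000), (67, -147197952000), (163, -262537412640768000)} : Finset (ℕ × ℚ))) ∧ (∀ (V V' : WeierstrassCurve ℚ) [V.IsElliptic] [V'.IsElliptic] (ψ : WeierstrassCurve.Isogeny V V'), ψ.IsCyclic → ψ.degree ∉ ({26, 35, 65, 125, 169} : Finset ℕ))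

-- parent: MazurKenkuBound · child (gen 1)
/--     item stmt-ABC-18225 · crux · rank 903 · closed · proved by Summit.ABC.ABC.Theorems.kenkuCompositeTables_proof @ 7702656755e2 (prover)
    parent: MazurKenkuBound · by operator
    why it might fail: TRUE in print (Kenku1982 p.200, Ligozat1975; Cremona: 15a1/21a1 |T|=8 r=0, 27a1 |T|=3 r=0). Risk formal, L: birational maps fibre-product → 15a1/21a1/27a1 to be found and certified (resultant-size identities, cf. the level-20 cofactor identities); 27 needs a 3-chain normal form not yet in tree.
    sources: Kenku1982, Ligozat1975, CremonaAlgorithms1997, SilvermanAEC2009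
[crux; split child C₁ of MazurKenkuBound (crux-strategist s2); REACHABLE NOW, L] The j-tables at the
three COMPOSITE tabulated levels: a cyclic rational isogeny of degree 15, 21 or 27 out of V forces
(deg, j(V)) into the nine rows −5²/2, −5²·241³/2³, −5·29³/2⁵, 5·211³/2¹⁵ (15); −3²·5⁶/2³, 3³·5³/2,
−3²·5³·101³/2²¹, −3³·5³·383³/2⁷ (21); −2¹⁵·3·5³ (27) (Kenku 1982 p. 200; Ligozat 1975; X₀(15) =
15a1, X₀(21) = 21a1, X₀(27) = 27a1, all genus 1 rank 0 with 8, 8, 3 rational points = 4+4, 4+4, 2+1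
cusps+points). Reachable by the method that PROVED levels 20 and 32 in this crux (lead c21: genus-0
fibre products + tree descents): a cyclic 15-isogeny gives j = R₃(s) = R₅(t) (tree Klein–Fricke
exists_j_eq_klein_three/five_of_…_dvd_degree), the fibre product {R₃(s) = R₅(t)} is birational over
ℚ to 15a1 = [1,1,1,−10,−10] whose Mordell–Weil group (ℤ/2 × ℤ/4, 7 affine points) is finite by
2-isogeny descent (TwoIsogenyDescent*) or by transfer from the tree's Kubert/X₁ determinations along
the isogeny class 15a; likewise 21 via {R₃(s) = R₇(t)} → 21a1 = [1,0,0,−4,−1] (ℤ/2 × ℤ/4); 27 via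
3-chains (three Klein–Fricke-3 steps with the cyclicity/vertex condition, as in the level-32
two-chain) → 27a1 = [0 -/
@[route_item "route-ABC-IsogenyGlueCongruence"]
def KenkuCompositeTables : Prop :=
  ∀ (V V' : WeierstrassCurve ℚ) [V.IsElliptic] [V'.IsElliptic] (ψ : WeierstrassCurve.Isogeny V V'), ψ.IsCyclic → ψ.degree ∈ ({15, 21, 27} : Finset ℕ) → (ψ.degree, V.j) ∈ ({((15 : ℕ), (-25 / 2 : ℚ)), (15, -349938025 / 8), (15, -121945 / 32), (15, 46969655 / 32768), (21, -140625 / 8), (21, 3375 / 2), (21, -1159088625 / 2097152), (21, -189613868625 / 128), (27, -12288000)} : Finset (ℕ × ℚ))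

-- parent: MazurKenkuBound · child (gen 1)
/--     item stmt-ABC-18226 · crux · rank 904 · closed · proved by Summit.ABC.ABC.Theorems.kenkuLevelFortyNine_proof @ ebf4d2427a6e (prover)
    parent: MazurKenkuBound · by operator
    why it might fail: TRUE in print (Ligozat1975; Kenku1982; Cremona 49a1: r=0, |T|=2, four CM curves 49a1–4 joined by 2- and 7-isogenies only). Risk formal, M–L: the explicit birational map {R₇(s)=R₇(t), s≠t} → 49a1 and a 2-isogeny descent for 49a1/49a2 (bad primes {7}; local insolubility at 7, 2, ∞).
    sources: Ligozat1975, Kenku1982, CremonaAlgorithms1997, SilvermanAEC2009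
[crux; split child C₂ of MazurKenkuBound (crux-strategist s2); REACHABLE NOW, M–L] No elliptic curve
over ℚ admits a cyclic rational isogeny of degree 49: X₀(49) ≅ X_sp(7) is the genus-one curve 49a1 =
[1,−1,0,−2,−1] (CM by −7) whose Mordell–Weil group {O, (2,−1)} ≅ ℤ/2 is its two rational cusps
(Ligozat 1975; Kenku 1982 p. 200; Cremona 49a1 r = 0, |T| = 2). Reachable by the method that proved
levels 20 and 32 here (genus-0 fibre product + tree descent): a cyclic 49-isogeny V → V' factors as
V →₇ V₁ →₇ V' and V₁ carries two DISTINCT rational 7-kernels (C/C[7] and V[7]/C[7]); with P(t) =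
(t²+13t+49)(t²+5t+1)³ (tree Klein–Fricke exists_j_eq_klein_seven_of_…, applied on V₁ to both
kernels; distinct kernels ⇒ distinct parameters because the kernel cubic is a function of t) one
gets s ≠ t in ℚˣ with P(s)/s = P(t)/t = j(V₁); conversely any such (s,t) yields a cyclic rational
49-isogeny E_s/B → E_s → E_s/A (quadratic twists preserve subgroups; j(V₁) ∉ {0,1728} automatically:
P has no rational root and P(t) − 1728t = (t⁴+14t³+63t²+70t−7)² has none). So C₂ ⟺ the Diophantine
statement `P(s)·t = P(t)·s, s t ≠ 0 ⟹ s = t` over ℚ. Model: on X₀(49), s = (η(7τ)/η(49τ))⁴ = h(7τ)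
and t = 49/h(τ) = 4 -/
@[route_item "route-ABC-IsogenyGlueCongruence"]
def KenkuLevelFortyNine : Prop :=
  ∀ (V V' : WeierstrassCurve ℚ) [V.IsElliptic] [V'.IsElliptic] (ψ : WeierstrassCurve.Isogeny V V'), ψ.IsCyclic → ψ.degree ≠ 49

-- parent: MazurKenkuBound · glue (gen 1)
/--     item stmt-ABC-18227 · support · rank 905 · closed · proved by Summit.ABC.ABC.Theorems.mazurKenkuBoundGlue_proof @ a6c8c4117afa (prover)
    parent: MazurKenkuBound · GLUE: children ⟹ parent · by operator
@glue-note.txt -/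
@[route_item "route-ABC-IsogenyGlueCongruence"]
def MazurKenkuBoundGlue : Prop :=
  MazurCor44 → KenkuPrintedLevels → KenkuCompositeTables → KenkuLevelFortyNine → MazurKenkuBound

/-- item stmt-ABC-15193 · crux · rank 9 · open · by planner
why it might fail: KNOWN in print (Mazur1978 Thm 1 + Kenku1982; AEC IX.6 Ex 6.4): cannot fail. Risk formal only, XL: Eisenstein-ideal proof of Mazur Thm 1 + the X₀(N)(ℚ) determinations of Kenku's levels (ccert of this item: 60/73 levels certified), none in Mathlib.
sources: Mazur1978, Kenku1982, SilvermanAEC2009, PastenShimura2024, arXiv:1705.09251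
[crux] MAZUR–KENKU RADIUS (route-choice cd68f10e, 2026-08-16: PROMOTION of the XL-apex Literature
fact Literature.NumberTheory.Automorphic.ShimuraParametrizationData.minimalDegree_le_163_mul —
hypothesis 5 of BOTH package theorems of this route, stub_twoPrimePackage_of_facts
(Theorems/RibetTakahashiSplitFewPrimeValuationProductStubTwoPrimePackage; crux r4 stmt-ABC-1563,
line switching-triangle, stub stub_twoPrimePackage) and jlPackage_printedClass_of_facts
(Theorems/RibetTakahashiSplitManyPrimeValuationProductJLPackagePrintedClass; r2 family
stmt-ABC-1561/15149/15174) — in the RADIUS form every consumer actually uses). Statement: two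
ℚ-isogenous elliptic curves over ℚ are joined by a ℚ-isogeny of degree ≤ 163 (Mazur 1978 Thm 1 +
Kenku 1982; Silverman AEC IX.6 Ex. 6.4; tree vocabulary WeierstrassCurve.IsIsogenous /
Isogeny.degree of Literature/NumberTheory/EllipticCurves/Isogeny). WHY THIS FORM. (i) The apex fact
is its PROVED corollary: glue minimalDegree_le_163_mul_of_radius : MazurKenkuRadius →
minimalDegree_le_163_mul (planner Sketch.lean, lean rc 0 — the tree's
deg_le_163_mul_deg_of_isIsogenous uses Mazur–Kenku only through exists_isogeny_degree_le_163), and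
so is the packages' -/
@[route_item "route-ABC-IsogenyGlueCongruence", crux]
def MazurKenkuRadius : Prop :=
  ∀ (W W' : WeierstrassCurve ℚ) [W.IsElliptic] [W'.IsElliptic], W.IsIsogenous W' → ∃ φ : WeierstrassCurve.Isogeny W W', φ.degree ≤ 163

/-- item stmt-ABC-15664 · crux · rank 9 · open · by planner
why it might fail: KNOWN (Faltings1983Endlichkeit §5 Satz 4 / Kor. 1; Cornell–Silverman Ch. II §5 pp. 89–90, page-verified): cannot fail in print. Risk formal only: residual = Finiteness I over ℚ (finite_isoClasses_isogenous: semistable reduction, moduli heights, Tate–Raynaud, Hodge–Tate) — XL, formalised nowhere.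
sources: Faltings1983Endlichkeit, Faltings1986FinitenessTranslation, MilneAV2008, Zarhin1985, MumfordAV1970, Milne1986AbelianVarieties
[crux, rank 9 — KNOWN in print, XL formal debt; route-choice PROMOTION (planner rchoice 4bc93807,
2026-08-16) re-attaching stmt-ABC-15017 (grounded KNOWN g43-0, crux-attack SURVIVES) after the
right-size of rev 18 dropped it. LOAD-BEARING for the lever U = EllipticGluingPrimeBound
(stmt-ABC-13919), NOT optional wiring: U ITSELF implies a Tate-type statement, so no re-plan of U's
line (Cruxes/EllipticGluingPrimeBound/Lines/Sketch.lean, stub_faltingsTate → stub_CMTorsionCoreOf →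
Aux8.false_of_eigenvector, used once) can avoid an input of this kind. PHANTOM ARGUMENT: let W/ℚ
have CM by K, χ = χ_K, and let (E, e) be an AV-model of W (E(ℚ̄) ≃ W(ℚ̄) Γ_ℚ-equivariantly, exactly
U's binders) with End(E_ℚ̄) = ℤ — excluded in print only by Faltings; A := E^χ (quadratic twist):
Hom_ℚ(E, A) = Hom_ℚ(A, E) = 0; for ℓ > L₀(W) the normaliser-of-Cartan shape of W[ℓ]
(cmTorsion_cartanImage) gives W[ℓ] ≅ W[ℓ] ⊗ χ (conjugate by a trace-zero element of the Cartan),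
hence an equivariant ι_ℓ : E[ℓ] ≅ A[ℓ]; B_ℓ := (E × A)/Graph(ι_ℓ), dim 2: every E-multiplier of B_ℓ
is ≡ 0 (mod ℓ) (β∘q = (m, 0) with m killing E[ℓ]; Hom_ℚ(E, B_ℓ) has rank 1 and q∘incl₁ = k·α₀ with ℓ
∤ k because q∘incl₁ is injective on E[ℓ]) -/
@[route_item "route-ABC-IsogenyGlueCongruence", crux]
def FaltingsTate : Prop :=
  ∀ (A B : Literature.AlgebraicGeometry.Motives.AbelianVariety.{0} ℚ) (ℓ : ℕ) [Fact ℓ.Prime] [NumberField ℚ], Function.Bijective (Literature.AlgebraicGeometry.Motives.AbelianVariety.faltingsTateMap A B ℓ)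

/-- item stmt-ABC-15990 · crux · rank 9 · closed · proved by Summit.ABC.ABC.Theorems.edixhovenIntegrality_proof @ 49fe5e324a86 (prover) · by planner
why it might fail: KNOWN (EdixhovenManin1991 Prop 2 = AgasheRibetStein2006 Thm 2.2; Gabber, arXiv:1911.09446 const-in-ℤ): cannot fail in print, faithfully stated. Risk formal only: Néron model + mapping property (exists_isNeronModel), X₀(N)_ℤ at ∞ + q-expansion principle, scheme↔analytic bridge — XL, not in Mathlib.
sources: EdixhovenManin1991, AgasheRibetStein2006, arXiv:1911.09446, Cesnavicius2018, BLRNeronModels1990, SilvermanATAEC1994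
[crux, rank 9 — KNOWN in print, XL formal debt; route-choice PROMOTION (planner rchoice cb3fc231,
2026-08-16) of the apex Literature fact
Literature.NumberTheory.EllipticCurves.edixhoven_int_of_neronLattice_eq_smul_periodLattice, whose
body this statement repeats VERBATIM (definitionally equal — planner Sketch.lean `Iff.rfl`: closable
by `exact …_holds` the day the fact is discharged, and it closes the MK lead's registered stub
`stub_edixhoven` by defeq)] EdixhovenIntegrality — Edixhoven 1991 Prop. 2 (the Manin constant of the
strong Weil curve is an integer) in lattice form: if a GLOBALLY MINIMAL elliptic W'/ℚ has a newform
f at some level N (IsNewformOf W' f) and a Néron-type period pair L' whose lattice is EXACTLY q·Λ_f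
for a rational q (so z ↦ qz is a ℚ-isomorphism ℂ/Λ_f ≅ W'(ℂ): W' is a minimal model of the optimal
quotient E_f and |q| is its Manin constant), then q ∈ ℤ. LOAD-BEARING input (I-opt) of the crux
MazurKenkuBound (stmt-ABC-15125): the landed line assembly mazurKenkuBound_of_four_facts
(Theorems/IsogenyGlueCongruenceMazurKenkuBoundProp51AndFourFacts) = Mazur1978 Cor 4.4 + Kenku levels
+ Néron scaling integrality (I-ell) + THIS, rewired to the item in planner Sketch. -/
@[route_item "route-ABC-IsogenyGlueCongruence", crux]
def EdixhovenIntegrality : Prop :=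
  ∀ {N : ℕ} [NeZero N] {W' : WeierstrassCurve ℚ} [W'.IsElliptic] [W'.IsGloballyMinimal] {f : CuspForm (CongruenceSubgroup.Gamma0 N) 2} {L' : PeriodPair}, Literature.NumberTheory.EllipticCurves.ModularForms.IsNewformOf W' f → Literature.NumberTheory.EllipticCurves.ModularForms.IsNeronLatticeOf (W'.baseChange ℂ) L' → ∀ q : ℚ, (∀ z ∈ Literature.NumberTheory.EllipticCurves.ModularForms.periodLattice f, (q : ℂ) * z ∈ L'.lattice) → (∀ z ∈ L'.lattice, ∃ w ∈ Literature.NumberTheory.EllipticCurves.ModularForms.periodLattice f, z = q * w) → ∃ k : ℤ, (k : ℚ) = q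

/-- item stmt-ABC-10870 · support · rank 9 · open · by planner
[support] NAMED FACT as item — verbatim the body of
Literature.NumberTheory.EllipticCurves.ModularForms.murty_petersson_newform_lower_bound
(NewformPeterssonSize.lean), closable by 'exact murty_petersson_newform_lower_bound_holds' the day
the fact is discharged: for every ε > 0 there is c > 0 with c·N^(1−ε) ≤ Re (f,f)_{Γ₀(N)} for every N
≥ 1, every elliptic W/ℚ and every f ∈ S₂(Γ₀(N)) with IsNewformOf W f (then N = N_W); (·,·) = the
tree's un-normalised peterssonProduct. In print: 2 log ‖f‖ ∼ log N (MurtyCongruencePrimes1999),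
lower bound via Rankin–Selberg (f,f) ≍ N^(1+o(1)) L(1, Sym² f) and L(1, Sym² f) ≫_ε N^(−ε)
(HoffsteinLockhart1994 with the Goldfeld–Hoffstein–Lieman appendix; Siegel for CM f). The ONE
undischarged input of the frame X → ABC of this route (Literature abcLe_of_semistableDegreeBound +
abcLt_of_abcLe; Silverman's inequality is PROVED, silverman1986_discriminant_c4_covolume_holds);
f-form, stronger than the D-forms RibetTakahashiSplit.PeterssonLowerBound (stmt-ABC-1565) /
QuaternionicDegree.PeterssonLowerBound (stmt-ABC-1720), which it implies with f := D.f. Not expected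
to be proved in Lean soon. Sources: HoffsteinLockhart1994, MurtyCongruencePrimes1999, PastenS -/
@[route_item "route-ABC-IsogenyGlueCongruence", crux]
def PeterssonLowerBound : Prop :=
  ∀ ε : ℝ, 0 < ε → ∃ c : ℝ, 0 < c ∧ ∀ (N : ℕ) [NeZero N] (W : WeierstrassCurve ℚ) [W.IsElliptic] (f : CuspForm (CongruenceSubgroup.Gamma0 N) 2), Literature.NumberTheory.EllipticCurves.ModularForms.IsNewformOf W f → c * (N : ℝ) ^ (1 - ε) ≤ (Literature.NumberTheory.EllipticCurves.ModularForms.peterssonProduct (CongruenceSubgroup.Gamma0 N) 2 f f).re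

/-- item stmt-ABC-10885 · support · rank 9 · closed · proved by Summit.ABC.ABC.Theorems.frameOverPetersson_proof (prover) · by planner
[support] S3 — the frame over the Petersson fact, PROVABLE NOW: (Petersson lower bound, = item
PeterssonLowerBound stmt-ABC-10870, inlined) → X → abc, concluding in Literature.Abc.ABCConjecture
(definitionally the summit statement, ABC := ABCConjecture). This is the known reduction
'modular-degree conjecture (semistable, sharp) ⟹ abc' (Frey1989; MurtyCongruencePrimes1999 Thm 1
(i); PastenShimura2024 §3) with its single undischarged analytic input explicit. In tree: fun hP hX
↦ abcLt_of_abcLe (abcLe_of_semistableDegreeBound hP silverman1986_discriminant_c4_covolume_holds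
(c_sq_form hX)), importing Literature.NumberTheory.EllipticCurves.DegreeConjectureAbcSemistable and
SilvermanHeightCovolumeProofs, where c_sq_form turns ∃D, deg ≤ C N^(2+ε) into deg ≤ max C 0 · c² ·
N^(2+ε) using c ∈ ℤ∖{0} (maninConstant_ne_zero_holds) — planner evidence AssemblyProof.lean attached
to this item (lean rc 0, axioms propext/choice/Quot.sound; ~25 lines to copy into
Summits/ABC/ABC/Theorems/). The deciding theorem of the route is meant to be closes hA hB hSharp hP
hFrame := hFrame hP (hSharp (hB hA)) once the route file can be edited again (see route notes:
multi-assembly stmt-ABC-3920 needs an operator -/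
@[route_item "route-ABC-IsogenyGlueCongruence", crux]
def FrameOverPetersson : Prop :=
  (∀ ε : ℝ, 0 < ε → ∃ c : ℝ, 0 < c ∧ ∀ (N : ℕ) [NeZero N] (W : WeierstrassCurve ℚ) [W.IsElliptic] (f : CuspForm (CongruenceSubgroup.Gamma0 N) 2), Literature.NumberTheory.EllipticCurves.ModularForms.IsNewformOf W f → c * (N : ℝ) ^ (1 - ε) ≤ (Literature.NumberTheory.EllipticCurves.ModularForms.peterssonProduct (CongruenceSubgroup.Gamma0 N) 2 f f).re) → SemistableDegreeConjecture → Literature.Abc.ABCConjecture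

/-- item stmt-ABC-13918 · support · rank 9 · open · by planner
[support, fact-shaped] SemistableHeightPolyBound: ∃ c, every semistable elliptic W/ℚ (global minimal
model) has stableFaltingsHeight W ≤ c·N², N the conductor. In print: h(E) < (1/48 + ε) N log N for
semistable E with N ≥ N₀(ε) (PastenShimura2024 Thm 1.9, vendored as pasten2024_height_lt with
neronLatticeHeight; = faltingsHeight = stableFaltingsHeight for a semistable minimal W,
faltingsHeight_eq_neg_half_log_covolume) and h(E) ≪ N log N for all E (MurtyPasten2013 Thm 1.1);
below the threshold N₀ finitely many isomorphism classes (Shafarevich/Faltings), so a crude exponent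
2 with one constant holds for all N. Closable from pasten2024_height_lt_holds + a finiteness fact.
Sources: PastenShimura2024, MurtyPasten2013. [difficulty: M given the facts] -/
@[route_item "route-ABC-IsogenyGlueCongruence"]
def SemistableHeightPolyBound : Prop :=
  ∃ c : ℝ, ∀ (W : WeierstrassCurve ℚ) [W.IsElliptic] [W.IsGloballyMinimal] [NeZero (W.conductorNorm ℤ)], W.IsSemistable ℤ → W.stableFaltingsHeight ≤ c * (W.conductorNorm ℤ : ℝ) ^ 2

/-- item stmt-ABC-13920 · support · rank 9 · open · by planner
[support, fact-shaped — the modular instance of U; long-lived like PeterssonLowerBound]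
ModularJacobianMultipliers: for every semistable elliptic W/ℚ (global minimal model, conductor N)
there are a modular parametrisation datum D of W at level N of MINIMAL degree, abelian varieties E,
J over ℚ with E(ℚ̄) ≃ W(ℚ̄) Γ_ℚ-equivariantly (E = W as an abelian variety:
WeierstrassCurve.nonempty_abelianVarietyBridge) and J = J₀(N) (Shimura: the Jacobian of X₀(N) is an
abelian variety over ℚ of dimension g₀(N) = dim S₂(Γ₀(N)) ≤ 1 + N∏_{p∣N}(1+1/p)/12 ≤ N²), a non-zero
E-multiplier of J, and the divisibility: every E-multiplier n of J (α ≫ β = n • 𝟙 E) is divisible by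
D.modularDegree. Proof sketch (Ribet/Zagier folklore: AgasheRibetStein2012 §2.1; ZagierCMB1985 Thm
3; CongruenceNumber.lean design notes): with π : J₀(N) → E₁ the optimal quotient attached to the
newform f of W and λ₁ : E₁ ≅ E₁^∨, Hom(J₀(N), W) = Hom(E₁, W)∘π (multiplicity one of f,
Atkin–Lehner) and Hom(W, J₀(N)) = π^∨∘λ₁∘Hom(W, E₁); π∘π^∨∘λ₁ = [m_{E₁}] (φ_*φ^* = deg φ); Hom(E₁,
W) = ℤψ₀, Hom(W, E₁) = ℤψ₀' with ψ₀ψ₀' = [deg ψ₀] (End_ℚ = ℤ); hence the multipliers are exactly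
m_{E₁}·deg ψ₀·ℤ, and the datum D given by ψ₀∘φ_{E₁} (Man -/
@[route_item "route-ABC-IsogenyGlueCongruence", crux]
def ModularJacobianMultipliers : Prop :=
  ∀ (W : WeierstrassCurve ℚ) [W.IsElliptic] [W.IsGloballyMinimal] [NeZero (W.conductorNorm ℤ)], W.IsSemistable ℤ → ∃ (D : Literature.NumberTheory.EllipticCurves.ModularForms.ModularParametrizationData W (W.conductorNorm ℤ)) (E J : Literature.AlgebraicGeometry.Motives.AbelianVariety.{0} ℚ) (e : E.geomPoints ≃+ W.geomPoints), (∀ (σ : Field.absoluteGaloisGroup ℚ) (P : E.geomPoints), e (σ • P) = σ • e P) ∧ (J.dim : ℝ) ≤ (W.conductorNorm ℤ : ℝ) ^ 2 ∧ (∃ (α : E ⟶ J) (β : J ⟶ E) (n : ℤ), n ≠ 0 ∧ CategoryTheory.CategoryStruct.comp α β = n • CategoryTheory.CategoryStruct.id E) ∧ (∀ (α : E ⟶ J) (β : J ⟶ E) (n : ℤ), CategoryTheory.CategoryStruct.comp α β = n • CategoryTheory.CategoryStruct.id E → (D.modularDegree : ℤ) ∣ n)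

/-- item stmt-ABC-13921 · support · rank 9 · closed · proved by Summit.ABC.ABC.Theorems.degreePrimesOfGluingBound_proof @ 13fbef908065 (prover) · by planner
[support — layer-2 glue, PROVABLE NOW] DegreePrimesOfGluingBound: U ∧ ModularJacobianMultipliers ∧
SemistableHeightPolyBound ⟹ crux A (DegreePrimesPolyBounded). Proof: given W, take D, E, J, e from
the Jacobian item; a prime ℓ ∣ D.modularDegree divides every E-multiplier of J and a non-zero
multiplier exists, so U gives ℓ ≤ C·(dim J · max(1, h_F(W)))^κ ≤ C·((max 1 c)·N⁴)^κ = C'·N^(4κ) (κ ≥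
0 is part of U; N ≥ 1 from NeZero; if C < 0 the hypotheses are contradictory and anything follows).
About 40 lines of Real.rpow bookkeeping (Real.rpow_le_rpow, Real.mul_rpow, Real.rpow_natCast,
monotonicity in the base for κ ≥ 0). Sources: this route (instances of U), PastenShimura2024.
[difficulty: S] -/
@[route_item "route-ABC-IsogenyGlueCongruence", crux]
def DegreePrimesOfGluingBound : Prop :=
  EllipticGluingPrimeBound → ModularJacobianMultipliers → SemistableHeightPolyBound → DegreePrimesPolyBounded

/-- item stmt-ABC-15126 · support · rank 9 · open · by planner
why it might fail: KNOWN (Wiles1995/TaylorWiles1995 semistable; BCDT2001 Thm A; Carayol; c ∈ ℤ Néron): cannot fail mathematically. Exact residual PROVED = exists_isNewformOf (iff, Theorems/IsogenyGlueCongruenceModularDatumExists). Risk formal only: R=T, Langlands–Tunnell, 3–5 switch; XL apex.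
sources: Wiles1995, TaylorWiles1995, BCDTJAMS2001, Carayol1986
[crux, rank 9 — KNOWN in print, XL formal debt; itemised 2026-08-16 (planner rchoice 1e5e4a86)
together with MazurKenkuBound so that the inputs of the K- and U-line of this route are route ITEMS
and no line assembly rests on an apex Literature fact — the assembly file
IsogenyGlueCongruenceDegreePrimesPolyBoundedOfTorsionSharing took BOTH
PastenShimura2024_minimalDegree_le_163_mul and exists_isNewformOf as hypotheses] ModularDatumExists
— modularity with an integral Manin constant, datum form, VERBATIM the body of
Literature.NumberTheory.EllipticCurves.ModularForms.nonempty_modularParametrizationData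
(definitionally equal, Sketch.lean `Iff.rfl`; closable by `exact
nonempty_modularParametrizationData_holds` the day the fact is discharged): every elliptic W/ℚ given
by a globally minimal model admits a ModularParametrizationData at level N_W = W.conductorNorm ℤ
(newform f with aₙ(f) = aₙ(W), Néron period pair and uniformisation, integer Manin constant c with
cΛ_f ⊆ Λ_W, degree). In print: Wiles1995 + TaylorWiles1995 (semistable — all the K-line needs),
Breuil–Conrad–Diamond–Taylor 2001 Thm A (all E/ℚ), level = conductor (Carayol1986), Eichler–Shimura
construction + Faltings' isogeny th -/
@[route_item "route-ABC-IsogenyGlueCongruence", crux]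
def ModularDatumExists : Prop :=
  ∀ (W : WeierstrassCurve ℚ) [W.IsElliptic] [W.IsGloballyMinimal] [NeZero (W.conductorNorm ℤ)], Nonempty (Literature.NumberTheory.EllipticCurves.ModularForms.ModularParametrizationData W (W.conductorNorm ℤ))

/-- item stmt-ABC-15128 · support · rank 9 · closed · proved by Summit.ABC.ABC.Theorems.semistableHeightPolyBoundOfMazurKenku_proof (prover) · by planner
[support — U-line glue, PROVABLE NOW (planner evidence Sketch.lean: complete proof, lean rc 0, 0
sorry, standard axioms)] SemistableHeightPolyBoundOfMazurKenku: MazurKenkuBound → ModularDatumExists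
→ SemistableHeightPolyBound — the crude height bound h_F(W) ≤ c·N² of the U-line
(SemistableHeightPolyBound, stmt-ABC-13918) derived from the two rank-9 formal-debt cruxes
MazurKenkuBound (stmt-ABC-15125) and ModularDatumExists (stmt-ABC-15126) (route-choice repair
2026-08-16, planner rchoice 1e5e4a86). One line: `fun hMK hmod ↦
Summit.ABC.ABC.Theorems.semistableHeightPolyBound_of_modularity_of_mazurKenku_of_thm_5_5 hmod hMK
Literature.NumberTheory.EllipticCurves.ModularForms.PastenShimura2024_thm_5_5_holds` — the classical
modular approach already landed in IsogenyGlueCongruenceSemistableHeightPolyBoundModular.lean (h(E)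
≤ ½ N log N + 9 for N ≫ 1 via the class-minimal datum, Mazur–Kenku and Pasten's Thm 5.5 — now the
tree theorem PastenShimura2024_thm_5_5_holds of
Literature/NumberTheory/EllipticCurves/PeriodRelationsProofs.lean —, Shafarevich finiteness below
the threshold), its two remaining Literature-fact hypotheses nonempty_modularParametrizationData /
PastenShimura2024_minimalDegr -/
@[route_item "route-ABC-IsogenyGlueCongruence", crux]
def SemistableHeightPolyBoundOfMazurKenku : Prop :=
  MazurKenkuBound → ModularDatumExists → SemistableHeightPolyBound

/-- item stmt-ABC-15911 · support · rank 9 · closed · proved by Summit.ABC.ABC.Theorems.isogenyGlueCongruence_peterssonOfSymmFour_proof @ 12089387de3e (prover) · by planner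
[support] WIRING, PROVABLE NOW in one line (route-choice repair e6b77e02, 2026-08-16): the promoted
crux implies the Petersson item — SymmFourAnalyticPackage → PeterssonLowerBound. Proof: `fun h =>
Summit.ABC.ABC.Theorems.PeterssonLowerBound_of h` (Theorems/DefiniteXiPeterssonLowerBound.lean,
p107692: line Sketch of stmt-ABC-10870 — Goldfeld–Hoffstein–Lieman on the Siegel ball, stubs p98483
p103615 p103973 p105349) for route DefiniteXi, and `fun h =>
Summit.ABC.ABC.Theorems.IsogenyGlueCongruence_PeterssonLowerBound_of h` (p114534) for route
IsogenyGlueCongruence; both typecheck because SymmFourAnalyticPackage is Iff.rfl the named fact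
Kim2003_symmFourL_nonCM_entire_polyBound (planner proof file PeterssonOfSymmFourProof.lean attached
as evidence, rc 0 on the farm — a prover lands it verbatim, e.g.
Theorems/DefiniteXiPeterssonOfSymmFour.lean). Literature twin:
murty_petersson_newform_lower_bound_of_symmFour (NewformPeterssonSizeSymmFourReductionProofs.lean,
PROVED). ROLE: the one extra binder that lets the CRUX-ONLY deciding theorem take hK :
SymmFourAnalyticPackage (crux) instead of the open support hP : PeterssonLowerBound without
importing Theorems (cyclic) or a heavy Literature p -/
@[route_item "route-ABC-IsogenyGlueCongruence"]
def PeterssonOfSymmFour : Prop :=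
  SymmFourAnalyticPackage → PeterssonLowerBound

/-- item stmt-ABC-16013 · support · rank 9 · open · by planner
why it might fail: KNOWN: optimal c₀ ∈ ℤ (EdixhovenManin1991 Prop 2 = ARS2006 Thm 2.2), |c₀| = 1 semistable (Cesnavicius2018 Thm 1.2; ≤ 2 by Mazur1978 Cor 4.1 + AbbesUllmo1996 Prop 3.1), Kenku ≤ 163, Néron scaling; cannot fail in print. Formal risk XL: Néron models (exists_isNeronModel), X₀(N)/ℤ at ∞.
sources: EdixhovenManin1991, AgasheRibetStein2006, Cesnavicius2018, Mazur1978, AbbesUllmo1996, Kenku1982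
[crux, rank 9 — KNOWN in print, XL formal debt; route-choice PROMOTION (planner rchoice 8cb3b1b0,
2026-08-16) of the Manin-constant package behind crux B's line: the XL-apex named fact
Literature.NumberTheory.EllipticCurves.edixhoven_int_of_neronLattice_eq_smul_periodLattice
(Edixhoven 1991 Prop 2 = Agashe–Ribet–Stein 2006 Thm 2.2, c₀ ∈ ℤ) TOGETHER WITH Česnavičius 2018 Thm
1.2 (|c₀| = 1 semistable; |c₀| ≤ 2 already by Mazur 1978 Cor 4.1 + Mazur–Raynaud / Abbes–Ullmo 1996
Prop 3.1), the Néron scaling integral_neronScaling_of_isGloballyMinimal (Silverman ATAEC IV.5.1) and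
the route item MazurKenkuBound (Kenku: cyclic ℚ-isogeny degree ≤ 163) — stated in the WEAKEST form
the line needs] SemistableManinBound: there is an absolute M₀ such that every GLOBALLY MINIMAL
elliptic W/ℚ carrying a modular parametrisation datum D at a SQUARE-FREE level N (then N = N_W and W
is semistable) carries a datum D' with the same newform and |c_{D'}| ≤ M₀ (in print M₀ = 163: every
parametrisation factors through the optimal quotient E_f followed by a cyclic isogeny ψ; c_{D'} = c₀
· n with c₀ the Manin constant of E_f, |c₀| = 1, and n the Néron scaling of ψ between minimal
models, n ∣ deg ψ ≤ 163). IN TRE -/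
@[route_item "route-ABC-IsogenyGlueCongruence", crux]
def SemistableManinBound : Prop :=
  ∃ M₀ : ℤ, ∀ (N : ℕ) [NeZero N] (W : WeierstrassCurve ℚ) [W.IsElliptic] [W.IsGloballyMinimal] (D : Literature.NumberTheory.EllipticCurves.ModularForms.ModularParametrizationData W N), Squarefree N → ∃ D' : Literature.NumberTheory.EllipticCurves.ModularForms.ModularParametrizationData W N, D'.f = D.f ∧ |D'.maninConstant| ≤ M₀

/-- item stmt-ABC-16014 · support · rank 9 · open · by planner
why it might fail: KNOWN in print (|c| ≤ 163: Edixhoven1991 Prop 2 c₀ ∈ ℤ; |c₀| ≤ 2 at squarefree N by Mazur1978 Cor 4.1 + AbbesUllmo1996, = 1 by Cesnavicius2018; Mazur–Kenku + Néron scaling; landed maninBound_of_facts p114821): cannot fail in print. Risk formal: Néron models / X₀(N)_ℤ absent — XL.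
sources: EdixhovenManin1991, AgasheRibetStein2006, Cesnavicius2018, Mazur1978, AbbesUllmo1996, Kenku1982
[crux, rank 9 — KNOWN in print, XL formal debt; route-choice PROMOTION (planner rchoice 44afd190,
2026-08-16) for the assembly file
Theorems/IsogenyGlueCongruencePolyDegreeOfBoundedPrimesOptimalCalibrationItems of crux B's line
`Sketch` (stmt-ABC-2046): the apex named facts Edixhoven 1991 Prop. 2
(`edixhoven_int_of_neronLattice_eq_smul_periodLattice`, judged XL-apex), Česnavičius 2018 Thm 1.2
(closure of `abs_maninConstant_eq_one_of_isSemistable`) and the Néron-scaling integrality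
(`integral_neronScaling_of_isGloballyMinimal`) enter that line ONLY through this consequence, which
is therefore the item; typed weakest-form (free exponent, GIVEN a datum — no modularity inside, no
hand-picked constant)] SemistableManinBound — polynomially bounded Manin constants at square-free
level: there are a, M₀ such that every globally minimal elliptic W/ℚ carrying a modular
parametrisation datum D at a square-free level N carries a datum D' at level N with |c_{D'}| ≤
M₀·N^a. IN PRINT with a = 0, M₀ = 163 (even 326 without Česnavičius): the strong Weil curve E₀ of f
= D.f on its minimal model has c₀ ∈ ℤ (Edixhoven 1991 Prop. 2 = Agashe–Ribet–Stein 2006 Thm 2.2, p.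
619) and, N being squarefree, |c₀| -/
@[route_item "route-ABC-IsogenyGlueCongruence", crux]
def SemistableManinBound2 : Prop :=
  ∃ a M₀ : ℝ, ∀ (N : ℕ) [NeZero N] (W : WeierstrassCurve ℚ) [W.IsElliptic] [W.IsGloballyMinimal] (D : Literature.NumberTheory.EllipticCurves.ModularForms.ModularParametrizationData W N), Squarefree N → ∃ D' : Literature.NumberTheory.EllipticCurves.ModularForms.ModularParametrizationData W N, |(D'.maninConstant : ℝ)| ≤ M₀ * (N : ℝ) ^ a

/-- item stmt-ABC-2049 · assembly · rank 1 · open · by planner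
sources: Frey1989, MurtyCongruencePrimes1999, PastenShimura2024, HoffsteinLockhart1994, ZagierCMB1985
[assembly] X → ABC: known reduction (Frey1989; MurtyCongruencePrimes1999 Thm 1, p.180;
PastenShimura2024 §3 and Rem 3.3; AgasheRibetStein2011 p.3). Proof plan over the tree: (1) reduce an
arbitrary abc triple to a normalised one (A ≡ −1 mod 4, 32 ∣ B) via (u^8, v^8 − u^8, v^8) on its two
odd members u < v: rad grows by a factor ≤ c^7 while the new c is ≥ (c/2)^8, so an exponent 1+ε for
normalised triples yields (1+ε)/(1−7ε) in general; (2) Frey curve freyCurve A B: semistable, N =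
rad(ABC) (conductorNorm_freyCurve_of_mod_holds, isSemistable_freyCurve_of_mod_holds, PROVED); pass
to a global minimal model (hasGlobalMinimalModel_of_isPrincipalIdealRing) keeping conductor,
semistability, Δ_min and c₄ up to units; (3) X gives D with deg ≤ C N^(2+ε) at level N = conductor
(level_eq_conductorNorm); Zagier (zagier_degree_formula_holds, PROVED): covol(D.L) = 4π²c²(f,f)/deg
≥ 4π²(f,f)/deg since c ∈ ℤ∖{0} (maninConstant_ne_zero) — no Manin conjecture needed; (4) FACT (cite
item): (f,f) ≥ C_ε·N^(1−ε) for the newform with a₁ = 1 of an elliptic curve of conductor N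
(HoffsteinLockhart1994 Thm 0.1 with the Goldfeld–Hoffstein–Lieman appendix; used in Murty 1999 §2);
(5) FACT (cite item, archimedean -/
@[route_item "route-ABC-IsogenyGlueCongruence"]
def Assembly : Prop :=
  SemistableDegreeConjecture → ABC

-- records of items no longer active in this route (dropped / restated):
-- earlier DegreePrimesOfCongruenceBound (stmt-ABC-14897, dropped 2026-08-16T14:44:06Z): proved by Summit.ABC.ABC.Theorems.degreePrimesOfCongruenceBound_proof @ 3df8881cdf11 — TorsionSharingPrimeBound → DegreePrimeCongruence → DegreePrimesPolyBounded
-- earlier DegreePrimeCongruenceOfMazurKenku (stmt-ABC-15127, dropped 2026-08-16T14:44:06Z): proved by Summit.ABC.ABC.Theorems.degreePrimeCongruenceOfMazurKenku_proof — MazurKenkuBound → ModularDatumExists → DegreePrimeCongruence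
-- earlier Assembly2 (stmt-ABC-3920, dropped 2026-08-16T14:15:59Z): proved by Summit.ABC.ABC.Theorems.isogenyGlueCongruence_assembly2_proof — (∀ ε : ℝ, 0 < ε → ∃ C : ℝ, ∀ a b c : ℕ, Literature.NumberTheory.DiophantineGeometry.IsABCTriple a b c → 32 ∣ b → (c : ℝ) ≤ C * ((Literature.NumberTheory.DiophantineGeometry.rad a b c : ℕ) : ℝ) ^ (1 + ε)) → ∀ ε : ℝ, 0 < ε → ∃ C : ℝ, 0 < C ∧ ∀ a b c : ℕ, Literatu

/-! D-0027 §2.1 — DECIDING THEOREM (planner-authored via `route open/edit --closes-file`; by planner-rchoice-ABC-IsogenyGlueCongruence-rq-r-f5c24d87-0 2026-08-16T14:44:06Z):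
its hypotheses are this route's items and its conclusion the sub-problem Statement (glue_lint), and it elaborates with this file. -/

@[closes "route-ABC-IsogenyGlueCongruence"] theorem closes (hU : EllipticGluingPrimeBound) (hJ : ModularJacobianMultipliers)
    (hMK : MazurKenkuBound) (hMod : ModularDatumExists)
    (hHofMK : SemistableHeightPolyBoundOfMazurKenku) (hGlueU : DegreePrimesOfGluingBound)
    (hB : PolyDegreeOfBoundedPrimes) (hSharp : SharpDegreeOfPolyDegree)
    (hP : PeterssonLowerBound) (hFrame : FrameOverPetersson) : _root_.ABC :=
  hFrame hP (hSharp (hB (hGlueU hU hJ (hHofMK hMK hMod))))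

end Summit.ABC.ABC.Theses.IsogenyGlueCongruence
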